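import Literature.Analysis.FluidPDE.PassiveVectorTensorEnergyDecay
import HarnessLib

/-!
# Energy-class stability of weak passive-vector solutions under perturbation of the carrier
# (constant coercive viscosity tensor, no Grönwall factor)

Analysis/FluidPDE proof-support file (everything proved; no definitions, no named facts). Two weak
solutions of Frisch's anisotropic-eddy-viscosity passive-vector equation (9.57),
`∂ₜw + (b·∇)w + ∇π = 𝓛_𝔸 w`, `∇·w = 0`, constant tensor in a Legendre–Hadamard window
`NearIso 𝔸 lo hi`, `0 < lo` (no symmetry), with the SAME datum `w₀ ∈ L²` but DIFFERENT bounded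
weakly divergence-free carriers — `w` along `b` (`‖b‖ ≤ M`), `u` along `b'`, `‖b − b'‖ ≤ δ` a.e. —
satisfy, for a.e. `t ∈ (0,T)`,

  `∫ ‖w(t) − u(t)‖² ≤ (d² δ² / (2 lo)) ∫₀ᵗ ∫ ‖u(s)‖² ds ≤ (d² δ² t / (2 lo)) ∫ ‖w₀‖²`

(`ae_integral_norm_sq_sub_le_of_carriers`, `ae_integral_norm_sq_sub_le_mul_datum`; drop form
`∫‖w(t)‖² ≤ ∫‖u(t)‖² + (2η + η²)∫‖w₀‖²`, `η² = d²δ²t/(2lo)`: `ae_integral_norm_sq_le_add_of_carriers`,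
amendment 1). There is NO
factor `exp(C M² t / lo)`: the transport term of the difference `z = w − u` along `b` is handled by
the antisymmetry of the trilinear form at the Galerkin level (`∫⟪P_N z,(b·∇)P_N z⟫ = 0`, remainder
`→ 0` by the Parseval tails), exactly as in the energy equality, and the cross term
`∫⟪u, ((b − b')·∇)P_N z⟫` is absorbed into the dissipation `lo ‖∇P_N z‖²`. This is the estimate the
K1L tail step needs (`stub_tailL`, cell `ad-ideate`: full carrier against its truncation at the
active level `j`, viscosity `lo = kbar_j → 0`, smallness ratio `δ_j²/kbar_j`).

Road (all `d`, general coupling `A` up to the flux identity, `A = 0` for the estimate):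
* `ae_inner_sub_eq` — the tested mode identity of the difference (datum cancels);
* `ae_sq_norm_sub_eq` — the mode energy identity of the difference (orthonormal basis of `k^⊥`);
* `ae_sum_sq_norm_sub_eq` — the Galerkin-truncated identity, Fourier form;
* `ae_galerkinFlux_sub_le` — the Fourier flux in physical variables, split
  `∫⟪z − P_N z,(b·∇)P_N z⟫ + ∫⟪u,((b−b')·∇)P_N z⟫` and bounded;
* `ae_integral_norm_sq_sub_le_of_carriers` — absorption and `N → ∞`.

## Mathlib / tree search

Tree: the tensor twin road `PassiveVectorTensorFourier/ModeEnergy/GalerkinIdentity/GalerkinTail/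
EnergyDecay` (mode identities, tails, energy inequality), the scalar dictionary
`PassiveVectorGalerkinIdentity` (`sum_mul_integral_inner_convect_eq`,
`integral_inner_convect_fourierTruncate_eq_remainder`, `abs_integral_inner_convect_le_of_norm_le`),
`TorusTrigPoly` (`toReal_eGradNormSq_realTrigPoly`, `realTrigPoly_sub`), `TorusVectorParseval`.
Robinson–Rodrigo–Sadowski 2016 §4.2 (Galerkin energy method); DiPerna–Lions 1989 §II.1 (stability
under perturbation of the transporting field); Evans 2010 §7.1.2.

## References

* J. C. Robinson, J. L. Rodrigo, W. Sadowski, *The three-dimensional Navier–Stokes equations*,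
  CUP 2016, §4.1–§4.2, Lemma 4.1, (4.20). [`RobinsonRodrigoSadowski2016`]
* R. J. DiPerna, P.-L. Lions, Invent. Math. 98 (1989), §II.1 Thm. II.1, (12)–(14). [`DiPernaLions1989`]
* L. C. Evans, *Partial Differential Equations*, 2nd ed. (AMS 2010), §7.1.2 Thm. 2. [`Evans2010`]
* U. Frisch, *Turbulence* (CUP 1995), §9.6.3 eq. (9.57) p. 233. [`Frisch1995Turbulence`]
* M. Giaquinta, *Multiple integrals in the calculus of variations* (Princeton 1983), Ch. III §2 (2.2).
  [`Giaquinta1983MultipleIntegrals`]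
* L. Grafakos, *Classical Fourier Analysis*, 3rd ed., GTM 249 (2014), Prop. 3.2.7. [`Grafakos2014`]
-/

noncomputable section

open MeasureTheory Set Filter Function TopologicalSpace Complex UnitAddTorus
open scoped ENNReal NNReal InnerProductSpace ComplexConjugate Topology

namespace Literature.Analysis.FluidPDE

namespace Torus

variable {d : Type*} [Fintype d] [DecidableEq d]

/-! ## Generic helpers (local copies) -/

section Helpers

omit [Fintype d] [DecidableEq d] in
/-- Product rule for an a.e. primitive with datum: `U(t) = c + ∫_{(0,t]} F` a.e. with `F ∈ L¹(0,T)`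
gives `U(t)² = c² + 2 ∫_{(0,t]} F U` a.e. [folklore] -/
private theorem ae_sq_eq_of_ae_eq_add_setIntegral₇ {T c : ℝ} {U F : ℝ → ℝ} (hF : IntegrableOn F (Ioo 0 T) volume)
    (hU : ∀ᵐ t ∂(volume.restrict (Ioo 0 T)), U t = c + ∫ τ in Ioc 0 t, F τ) :
    ∀ᵐ t ∂(volume.restrict (Ioo 0 T)), U t ^ 2 = c ^ 2 + 2 * ∫ τ in Ioc 0 t, F τ * U τ := by
  have hU' : ∀ᵐ τ ∂(volume : Measure ℝ), τ ∈ Ioo 0 T → U τ = c + ∫ r in Ioc 0 τ, F r :=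
    (ae_restrict_iff' measurableSet_Ioo).1 hU
  filter_upwards [hU, ae_restrict_mem measurableSet_Ioo] with t ht htT
  have hsub : Ioc 0 t ⊆ Ioo 0 T := Ioc_subset_Ioo_right htT.2
  rw [ht, sq_const_add_setIntegral_eq (hF.mono_set hsub)]
  congr 1
  congr 1
  refine setIntegral_congr_ae measurableSet_Ioc ?_
  filter_upwards [hU'] with τ hτ hτI
  rw [hτ (hsub hτI)]

omit [Fintype d] [DecidableEq d] in
/-- `Re a · Re h + Im a · Im h = Re (conj a · h)`. [folklore] -/
private theorem re_mul_re_add_im_mul_im₇ (a h : ℂ) : a.re * h.re + a.im * h.im = (conj a * h).re := by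
  simp [Complex.mul_re, Complex.conj_re, Complex.conj_im]

omit [Fintype d] [DecidableEq d] in
/-- `‖a‖² = (Re a)² + (Im a)²`. [folklore] -/
private theorem norm_sq_eq_re_sq_add_im_sq₇ (a : ℂ) : ‖a‖ ^ 2 = a.re ^ 2 + a.im ^ 2 := by
  rw [Complex.sq_norm, Complex.normSq_apply]
  ring

omit [Fintype d] [DecidableEq d] in
/-- **Quadratic identity for a complex a.e. primitive**: `α(t) = α₀ + ∫_{(0,t]} H` a.e. with
`H ∈ L¹(0,T)` and `α` essentially bounded gives `|α(t)|² = |α₀|² + 2 ∫_{(0,t]} Re(ᾱ H)` a.e.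
[folklore] -/
private theorem ae_norm_sq_eq_of_ae_eq_add_setIntegral₇ {T : ℝ} {α H : ℝ → ℂ} {α₀ : ℂ}
    (hHi : IntegrableOn H (Ioo 0 T) volume) (hαi : IntegrableOn α (Ioo 0 T) volume) {K : ℝ}
    (hK : ∀ᵐ τ ∂(volume.restrict (Ioo 0 T)), ‖α τ‖ ≤ K)
    (hid : ∀ᵐ t ∂(volume.restrict (Ioo 0 T)), α t = α₀ + ∫ τ in Ioc 0 t, H τ) :
    ∀ᵐ t ∂(volume.restrict (Ioo 0 T)), ‖α t‖ ^ 2 = ‖α₀‖ ^ 2 + 2 * ∫ τ in Ioc 0 t, (conj (α τ) * H τ).re := by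
  have hre : ∀ᵐ t ∂(volume.restrict (Ioo 0 T)), (α t).re = α₀.re + ∫ τ in Ioc 0 t, (H τ).re := by
    filter_upwards [hid, ae_restrict_mem measurableSet_Ioo] with t ht htT
    rw [ht, Complex.add_re, re_integral_eq (hHi.mono_set (Ioc_subset_Ioo_right htT.2))]
  have him : ∀ᵐ t ∂(volume.restrict (Ioo 0 T)), (α t).im = α₀.im + ∫ τ in Ioc 0 t, (H τ).im := by
    filter_upwards [hid, ae_restrict_mem measurableSet_Ioo] with t ht htT
    rw [ht, Complex.add_im, im_integral_eq (hHi.mono_set (Ioc_subset_Ioo_right htT.2))]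
  have h1 := ae_sq_eq_of_ae_eq_add_setIntegral₇ hHi.re hre
  have h2 := ae_sq_eq_of_ae_eq_add_setIntegral₇ hHi.im him
  have hP1 : IntegrableOn (fun τ => (H τ).re * (α τ).re) (Ioo 0 T) volume := by
    have hαm : AEStronglyMeasurable (fun τ => (α τ).re) (volume.restrict (Ioo 0 T)) :=
      Complex.continuous_re.comp_aestronglyMeasurable hαi.aestronglyMeasurable
    refine Integrable.mul_bdd (c := K) hHi.re hαm ?_
    filter_upwards [hK] with τ hτ
    rw [Real.norm_eq_abs]
    exact (Complex.abs_re_le_norm _).trans hτ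
  have hP2 : IntegrableOn (fun τ => (H τ).im * (α τ).im) (Ioo 0 T) volume := by
    have hαm : AEStronglyMeasurable (fun τ => (α τ).im) (volume.restrict (Ioo 0 T)) :=
      Complex.continuous_im.comp_aestronglyMeasurable hαi.aestronglyMeasurable
    refine Integrable.mul_bdd (c := K) hHi.im hαm ?_
    filter_upwards [hK] with τ hτ
    rw [Real.norm_eq_abs]
    exact (Complex.abs_im_le_norm _).trans hτ
  filter_upwards [h1, h2, ae_restrict_mem measurableSet_Ioo] with t ht1 ht2 htT
  simp only [RCLike.re_to_complex, RCLike.im_to_complex] at ht1 ht2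
  have hsub : Ioc 0 t ⊆ Ioo 0 T := Ioc_subset_Ioo_right htT.2
  rw [norm_sq_eq_re_sq_add_im_sq₇, norm_sq_eq_re_sq_add_im_sq₇ α₀, ht1, ht2, add_add_add_comm, ← mul_add,
    ← integral_add (hP1.mono_set hsub) (hP2.mono_set hsub)]
  congr 2
  refine integral_congr_ae (ae_of_all _ fun τ => ?_)
  have e1 : (H τ).re * (α τ).re + (H τ).im * (α τ).im = (conj (α τ) * H τ).re := by
    rw [← re_mul_re_add_im_mul_im₇]
    ring
  exact e1

omit [DecidableEq d] in
/-- `∑ⱼ aⱼ (μ fⱼ) = μ ∑ⱼ aⱼ fⱼ`. [folklore] -/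
private theorem modeRHS_sumpull₇ (k : d → ℤ) (μ : ℂ) (f : d → ℂ) :
    ∑ j, (2 * Real.pi * I * (k j)) * (μ * f j) = μ * ∑ j, (2 * Real.pi * I * (k j)) * f j := by
  rw [Finset.mul_sum]
  exact Finset.sum_congr rfl fun j _ => by ring

omit [DecidableEq d] in
/-- Linearity of the tested mode right-hand side in the test vector. [folklore] -/
private theorem modeRHS_sum_smul₇ {ι : Type*} (s : Finset ι) (𝔸 : Visc4 d) (k : d → ℤ) (A : ℝ)
    (X : EuclideanSpace ℂ d) (F G : d → EuclideanSpace ℂ d) (μ : ι → ℂ) (e : ι → EuclideanSpace ℂ d) :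
    (-(4 * Real.pi ^ 2 : ℝ) : ℂ) * ⟪X, symbT 𝔸 k (∑ i ∈ s, μ i • e i)⟫_ℂ +
        ((∑ j, (2 * Real.pi * I * (k j)) * ⟪F j, ∑ i ∈ s, μ i • e i⟫_ℂ) +
          (A : ℂ) * ∑ j, (2 * Real.pi * I * (k j)) * ⟪G j, ∑ i ∈ s, μ i • e i⟫_ℂ) =
      ∑ i ∈ s, μ i * ((-(4 * Real.pi ^ 2 : ℝ) : ℂ) * ⟪X, symbT 𝔸 k (e i)⟫_ℂ +
        ((∑ j, (2 * Real.pi * I * (k j)) * ⟪F j, e i⟫_ℂ) + (A : ℂ) * ∑ j, (2 * Real.pi * I * (k j)) * ⟪G j, e i⟫_ℂ)) := by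
  classical
  induction s using Finset.induction_on with
  | empty => simp
  | insert a s ha ih =>
    rw [Finset.sum_insert ha, Finset.sum_insert ha, ← ih]
    simp only [symbT_add, symbT_smul, inner_add_right, inner_smul_right, mul_add, Finset.sum_add_distrib,
      modeRHS_sumpull₇]
    ring

omit [DecidableEq d] in
/-- The tested mode right-hand sides are linear: `H₁ − H₂` is the right-hand side of the differences.
[folklore] -/
private theorem modeRHS_sub₇ (c : ℂ) (A : ℝ) (k : d → ℤ) (X₁ X₂ : ℂ) (F₁ F₂ G₁ G₂ : d → ℂ) :
    (c * X₁ + ((∑ j, (2 * Real.pi * I * (k j)) * F₁ j) + (A : ℂ) * ∑ j, (2 * Real.pi * I * (k j)) * G₁ j)) -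
        (c * X₂ + ((∑ j, (2 * Real.pi * I * (k j)) * F₂ j) + (A : ℂ) * ∑ j, (2 * Real.pi * I * (k j)) * G₂ j)) =
      c * (X₁ - X₂) + ((∑ j, (2 * Real.pi * I * (k j)) * (F₁ j - F₂ j)) +
        (A : ℂ) * ∑ j, (2 * Real.pi * I * (k j)) * (G₁ j - G₂ j)) := by
  simp only [mul_sub, Finset.sum_sub_distrib]
  ring

omit [DecidableEq d] in
/-- Parseval in a subspace: `Σᵢ |⟪X, eᵢ⟫|² = ‖X‖²` for `X ∈ S`. [folklore] -/
private theorem sum_sq_norm_inner_onb₇ {ι : Type*} [Fintype ι] {S : Submodule ℂ (EuclideanSpace ℂ d)}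
    (b : OrthonormalBasis ι ℂ S) {X : EuclideanSpace ℂ d} (hX : X ∈ S) :
    ∑ i, ‖⟪X, (b i : EuclideanSpace ℂ d)⟫_ℂ‖ ^ 2 = ‖X‖ ^ 2 := by
  have h1 : ‖(⟨X, hX⟩ : S)‖ ^ 2 = ∑ i, ‖b.repr ⟨X, hX⟩ i‖ ^ 2 := by
    rw [← b.repr.norm_map, EuclideanSpace.norm_sq_eq]
  have h2 : ∀ i, b.repr ⟨X, hX⟩ i = ⟪(b i : EuclideanSpace ℂ d), X⟫_ℂ := fun i => by
    rw [OrthonormalBasis.repr_apply_apply, Submodule.coe_inner]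
  rw [show ‖X‖ = ‖(⟨X, hX⟩ : S)‖ from rfl, h1]
  refine Finset.sum_congr rfl fun i _ => ?_
  rw [h2, norm_inner_symm]

omit [DecidableEq d] in
/-- Expansion in a subspace with conjugated coefficients: `Σᵢ conj⟪X, eᵢ⟫ eᵢ = X` for `X ∈ S`.
[folklore] -/
private theorem sum_conj_inner_smul_onb₇ {ι : Type*} [Fintype ι] {S : Submodule ℂ (EuclideanSpace ℂ d)}
    (b : OrthonormalBasis ι ℂ S) {X : EuclideanSpace ℂ d} (hX : X ∈ S) :
    ∑ i, conj ⟪X, (b i : EuclideanSpace ℂ d)⟫_ℂ • (b i : EuclideanSpace ℂ d) = X := by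
  have h := b.sum_repr' ⟨X, hX⟩
  have h' := congrArg (fun v : S => (v : EuclideanSpace ℂ d)) h
  simp only [Submodule.coe_sum, Submodule.coe_smul, Submodule.coe_inner] at h'
  simp_rw [inner_conj_symm]
  exact h'

omit [Fintype d] [DecidableEq d] in
/-- Cauchy–Schwarz for `∫ √f √g` with nonnegative integrable `f`, `g`. [folklore] -/
private theorem integral_sqrt_mul_sqrt_le₇ {α : Type*} [MeasurableSpace α] {μ : Measure α} {f g : α → ℝ}
    (hf : Integrable f μ) (hg : Integrable g μ) (hf0 : 0 ≤ᵐ[μ] f) (hg0 : 0 ≤ᵐ[μ] g) :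
    ∫ x, Real.sqrt (f x) * Real.sqrt (g x) ∂μ ≤ Real.sqrt (∫ x, f x ∂μ) * Real.sqrt (∫ x, g x ∂μ) := by
  have hmem : ∀ {φ : α → ℝ}, Integrable φ μ → 0 ≤ᵐ[μ] φ →
      MemLp (fun x => Real.sqrt (φ x)) (ENNReal.ofReal 2) μ := by
    intro φ hφ hφ0
    rw [show ENNReal.ofReal 2 = 2 by simp]
    refine (memLp_two_iff_integrable_sq (Real.continuous_sqrt.comp_aestronglyMeasurable hφ.1)).2 ?_
    refine hφ.congr ?_
    filter_upwards [hφ0] with x hx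
    rw [Real.sq_sqrt hx]
  have h := integral_mul_le_Lp_mul_Lq_of_nonneg Real.HolderConjugate.two_two
    (ae_of_all _ fun x => Real.sqrt_nonneg (f x)) (ae_of_all _ fun x => Real.sqrt_nonneg (g x)) (hmem hf hf0) (hmem hg hg0)
  have e1 : ∫ x, Real.sqrt (f x) ^ (2 : ℝ) ∂μ = ∫ x, f x ∂μ := by
    refine integral_congr_ae ?_
    filter_upwards [hf0] with x hx
    rw [Real.rpow_two, Real.sq_sqrt hx]
  have e2 : ∫ x, Real.sqrt (g x) ^ (2 : ℝ) ∂μ = ∫ x, g x ∂μ := by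
    refine integral_congr_ae ?_
    filter_upwards [hg0] with x hx
    rw [Real.rpow_two, Real.sq_sqrt hx]
  rw [e1, e2] at h
  simpa [Real.sqrt_eq_rpow] using h

omit [DecidableEq d] in
/-- A real trigonometric polynomial as the sum of its single real modes. [folklore] -/
private theorem realTrigPoly_eq_sum_singleton₇ (S : Finset (d → ℤ)) (c : (d → ℤ) → EuclideanSpace ℂ d) :
    FunctionSpaces.Torus.realTrigPoly S c = fun y => ∑ k ∈ S,
      (1 : ℝ) • FunctionSpaces.Torus.realTrigPoly {k} c y := by
  funext y
  rw [FunctionSpaces.Torus.realTrigPoly_apply_eq_sum]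
  refine Finset.sum_congr rfl fun k _ => ?_
  rw [one_smul, FunctionSpaces.Torus.realTrigPoly_apply_eq_sum, Finset.sum_singleton]

omit [DecidableEq d] in
/-- Integrability of `s ↦ ⟪F s, X s⟫` for `F ∈ L¹(0,T)` and `X` essentially bounded and measurable.
[folklore] -/
private theorem integrableOn_inner_of_norm_le₇ {T : ℝ} {F X : ℝ → EuclideanSpace ℂ d}
    (hF : IntegrableOn F (Ioo 0 T) volume) (hX : AEStronglyMeasurable X (volume.restrict (Ioo 0 T)))
    {K : ℝ} (hK : ∀ᵐ s ∂(volume.restrict (Ioo 0 T)), ‖X s‖ ≤ K) :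
    IntegrableOn (fun s => ⟪F s, X s⟫_ℂ) (Ioo 0 T) volume := by
  refine Integrable.mono' (hF.norm.mul_const K) (hF.aestronglyMeasurable.inner hX) ?_
  filter_upwards [hK] with s hs
  exact (norm_inner_le_norm _ _).trans (mul_le_mul_of_nonneg_left hs (norm_nonneg _))

end Helpers

/-! ## The difference of two weak solutions with different carriers: mode identities -/

section Difference

namespace IsWeakTensorPassiveVectorOn

variable {A T : ℝ} {𝔸 : Visc4 d} {b b' w u : ℝ → UnitAddTorus d → EuclideanSpace ℝ d}
  {w₀ : UnitAddTorus d → EuclideanSpace ℝ d}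

/-- **The tested mode identity of the difference.** For `w` (carrier `b`) and `u` (carrier `b'`) in
the tensor class with the same `𝔸`, `A` and integrable datum, a frequency `k` and a transversal test
vector `ζ` (`∑ kⱼ ζⱼ = 0`): for a.e. `t ∈ (0,T)`,
`⟪ŵ(t)(k) − û(t)(k), ζ⟫ = ∫_{(0,t]} ( −4π² ⟪ŵ − û, T_𝔸(k) ζ⟫ + ∑ⱼ 2πikⱼ ⟪𝓕(bⱼw) − 𝓕(b'ⱼu), ζ⟫
  + A ∑ⱼ 2πikⱼ ⟪𝓕(wⱼb) − 𝓕(uⱼb'), ζ⟫ )` (the datum cancels).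
[cite: RobinsonRodrigoSadowski2016, §4.1 (Galerkin truncations)] [cite: DiPernaLions1989, §II.1 (13)–(14)] -/
theorem ae_inner_sub_eq (h₁ : IsWeakTensorPassiveVectorOn A T 𝔸 b w₀ w)
    (h₂ : IsWeakTensorPassiveVectorOn A T 𝔸 b' w₀ u) (hw₀ : Integrable w₀ volume) (k : d → ℤ)
    {ζ : EuclideanSpace ℂ d} (hζ : ∑ j, (k j : ℂ) * ζ j = 0) :
    ∀ᵐ t ∂(volume.restrict (Ioo 0 T)),
      ⟪mFourierCoeff (FunctionSpaces.EuclideanSpace.complexify ∘ w t) k -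
          mFourierCoeff (FunctionSpaces.EuclideanSpace.complexify ∘ u t) k, ζ⟫_ℂ =
        ∫ τ in Ioc 0 t,
          ((-(4 * Real.pi ^ 2 : ℝ) : ℂ) *
              ⟪mFourierCoeff (FunctionSpaces.EuclideanSpace.complexify ∘ w τ) k -
                mFourierCoeff (FunctionSpaces.EuclideanSpace.complexify ∘ u τ) k, symbT 𝔸 k ζ⟫_ℂ +
            ((∑ j, (2 * Real.pi * I * (k j)) *
                ⟪mFourierCoeff (FunctionSpaces.EuclideanSpace.complexify ∘ fun x => b τ x j • w τ x) k -
                  mFourierCoeff (FunctionSpaces.EuclideanSpace.complexify ∘ fun x => b' τ x j • u τ x) k, ζ⟫_ℂ) +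
              (A : ℂ) * ∑ j, (2 * Real.pi * I * (k j)) *
                ⟪mFourierCoeff (FunctionSpaces.EuclideanSpace.complexify ∘ fun x => w τ x j • b τ x) k -
                  mFourierCoeff (FunctionSpaces.EuclideanSpace.complexify ∘ fun x => u τ x j • b' τ x) k, ζ⟫_ℂ)) := by
  have hH₁ := h₁.integrableOn_modeRHS k ζ
  have hH₂ := h₂.integrableOn_modeRHS k ζ
  filter_upwards [h₁.ae_inner_mFourierCoeff_eq hw₀ k hζ, h₂.ae_inner_mFourierCoeff_eq hw₀ k hζ,
    ae_restrict_mem measurableSet_Ioo] with t ht1 ht2 htT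
  have hsub : Ioc 0 t ⊆ Ioo 0 T := Ioc_subset_Ioo_right htT.2
  rw [inner_sub_left, ht1, ht2, add_sub_add_left_eq_sub,
    ← integral_sub (IntegrableOn.mono_set hH₁ hsub) (IntegrableOn.mono_set hH₂ hsub)]
  refine integral_congr_ae (ae_of_all _ fun s => ?_)
  dsimp only
  rw [modeRHS_sub₇, ← inner_sub_left]
  simp_rw [← inner_sub_left]

/-- Integrability on `(0,T)` of the tested mode right-hand side of the difference.
[cite: RobinsonRodrigoSadowski2016, §4.1 (Galerkin truncations)] -/
theorem integrableOn_modeRHS_sub (h₁ : IsWeakTensorPassiveVectorOn A T 𝔸 b w₀ w)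
    (h₂ : IsWeakTensorPassiveVectorOn A T 𝔸 b' w₀ u) (k : d → ℤ) (ζ : EuclideanSpace ℂ d) :
    IntegrableOn (fun τ =>
      (-(4 * Real.pi ^ 2 : ℝ) : ℂ) *
          ⟪mFourierCoeff (FunctionSpaces.EuclideanSpace.complexify ∘ w τ) k -
            mFourierCoeff (FunctionSpaces.EuclideanSpace.complexify ∘ u τ) k, symbT 𝔸 k ζ⟫_ℂ +
        ((∑ j, (2 * Real.pi * I * (k j)) *
            ⟪mFourierCoeff (FunctionSpaces.EuclideanSpace.complexify ∘ fun x => b τ x j • w τ x) k -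
              mFourierCoeff (FunctionSpaces.EuclideanSpace.complexify ∘ fun x => b' τ x j • u τ x) k, ζ⟫_ℂ) +
          (A : ℂ) * ∑ j, (2 * Real.pi * I * (k j)) *
            ⟪mFourierCoeff (FunctionSpaces.EuclideanSpace.complexify ∘ fun x => w τ x j • b τ x) k -
              mFourierCoeff (FunctionSpaces.EuclideanSpace.complexify ∘ fun x => u τ x j • b' τ x) k, ζ⟫_ℂ)) (Ioo 0 T) volume := by
  have h := (h₁.integrableOn_modeRHS k ζ).sub (h₂.integrableOn_modeRHS k ζ)
  refine h.congr (ae_of_all _ fun τ => ?_)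
  dsimp only
  rw [Pi.sub_apply, modeRHS_sub₇, ← inner_sub_left]
  simp_rw [← inner_sub_left]

/-- A common essential bound for the difference mode `ŵ(·)(k) − û(·)(k)` on `(0,T)`, and its
integrability. [cite: RobinsonRodrigoSadowski2016, §4.2 (Galerkin energy estimate)] -/
theorem exists_ae_norm_sub_le (h₁ : IsWeakTensorPassiveVectorOn A T 𝔸 b w₀ w)
    (h₂ : IsWeakTensorPassiveVectorOn A T 𝔸 b' w₀ u) (k : d → ℤ) :
    ∃ K : ℝ, 0 ≤ K ∧ (∀ᵐ τ ∂(volume.restrict (Ioo 0 T)),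
      ‖mFourierCoeff (FunctionSpaces.EuclideanSpace.complexify ∘ w τ) k -
          mFourierCoeff (FunctionSpaces.EuclideanSpace.complexify ∘ u τ) k‖ ≤ K) ∧
      IntegrableOn (fun τ => mFourierCoeff (FunctionSpaces.EuclideanSpace.complexify ∘ w τ) k -
          mFourierCoeff (FunctionSpaces.EuclideanSpace.complexify ∘ u τ) k) (Ioo 0 T) volume := by
  obtain ⟨K₁, hK₁, hb₁⟩ := h₁.exists_ae_norm_mFourierCoeff_le k
  obtain ⟨K₂, hK₂, hb₂⟩ := h₂.exists_ae_norm_mFourierCoeff_le k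
  refine ⟨K₁ + K₂, add_nonneg hK₁ hK₂, ?_, (h₁.integrableOn_mFourierCoeff k).sub (h₂.integrableOn_mFourierCoeff k)⟩
  filter_upwards [hb₁, hb₂] with τ h1 h2
  exact (norm_sub_le _ _).trans (add_le_add h1 h2)

/-- **The tested quadratic identity of the difference**: for transversal `ζ` and a.e. `t ∈ (0,T)`,
`|⟪ŵ(t)(k) − û(t)(k), ζ⟫|² = 2 ∫_{(0,t]} Re( conj⟪ŵ − û, ζ⟫ · H^{w−u}_k(ζ) )`, `H^{w−u}_k(ζ)` the
integrand of `ae_inner_sub_eq`. [cite: RobinsonRodrigoSadowski2016, §4.2 (Galerkin energy estimate)] -/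
theorem ae_sq_norm_inner_sub_eq (h₁ : IsWeakTensorPassiveVectorOn A T 𝔸 b w₀ w)
    (h₂ : IsWeakTensorPassiveVectorOn A T 𝔸 b' w₀ u) (hw₀ : Integrable w₀ volume) (k : d → ℤ)
    {ζ : EuclideanSpace ℂ d} (hζ : ∑ j, (k j : ℂ) * ζ j = 0) :
    ∀ᵐ t ∂(volume.restrict (Ioo 0 T)),
      ‖⟪mFourierCoeff (FunctionSpaces.EuclideanSpace.complexify ∘ w t) k -
          mFourierCoeff (FunctionSpaces.EuclideanSpace.complexify ∘ u t) k, ζ⟫_ℂ‖ ^ 2 =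
        2 * ∫ τ in Ioc 0 t,
          (conj ⟪mFourierCoeff (FunctionSpaces.EuclideanSpace.complexify ∘ w τ) k -
              mFourierCoeff (FunctionSpaces.EuclideanSpace.complexify ∘ u τ) k, ζ⟫_ℂ *
            ((-(4 * Real.pi ^ 2 : ℝ) : ℂ) *
                ⟪mFourierCoeff (FunctionSpaces.EuclideanSpace.complexify ∘ w τ) k -
                  mFourierCoeff (FunctionSpaces.EuclideanSpace.complexify ∘ u τ) k, symbT 𝔸 k ζ⟫_ℂ +
              ((∑ j, (2 * Real.pi * I * (k j)) *
                  ⟪mFourierCoeff (FunctionSpaces.EuclideanSpace.complexify ∘ fun x => b τ x j • w τ x) k -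
                    mFourierCoeff (FunctionSpaces.EuclideanSpace.complexify ∘ fun x => b' τ x j • u τ x) k, ζ⟫_ℂ) +
                (A : ℂ) * ∑ j, (2 * Real.pi * I * (k j)) *
                  ⟪mFourierCoeff (FunctionSpaces.EuclideanSpace.complexify ∘ fun x => w τ x j • b τ x) k -
                    mFourierCoeff (FunctionSpaces.EuclideanSpace.complexify ∘ fun x => u τ x j • b' τ x) k, ζ⟫_ℂ))).re := by
  obtain ⟨K, -, hK, hXi⟩ := exists_ae_norm_sub_le h₁ h₂ k
  have hαi : IntegrableOn (fun τ => ⟪mFourierCoeff (FunctionSpaces.EuclideanSpace.complexify ∘ w τ) k -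
      mFourierCoeff (FunctionSpaces.EuclideanSpace.complexify ∘ u τ) k, ζ⟫_ℂ) (Ioo 0 T) volume := hXi.inner_const ζ
  have hKζ : ∀ᵐ τ ∂(volume.restrict (Ioo 0 T)), ‖⟪mFourierCoeff (FunctionSpaces.EuclideanSpace.complexify ∘ w τ) k -
      mFourierCoeff (FunctionSpaces.EuclideanSpace.complexify ∘ u τ) k, ζ⟫_ℂ‖ ≤ K * ‖ζ‖ := by
    filter_upwards [hK] with τ hτ
    exact (norm_inner_le_norm _ _).trans (mul_le_mul_of_nonneg_right hτ (norm_nonneg _))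
  have hid := ae_inner_sub_eq h₁ h₂ hw₀ k hζ
  have h := ae_norm_sq_eq_of_ae_eq_add_setIntegral₇ (α₀ := 0) (integrableOn_modeRHS_sub h₁ h₂ k ζ) hαi hKζ
    (by filter_upwards [hid] with t ht; rw [zero_add]; exact ht)
  filter_upwards [h] with t ht
  rw [ht, norm_zero]
  ring

/-- **The mode energy identity of the difference**: for every `k` and a.e. `t ∈ (0,T)`,
`‖ŵ(t)(k) − û(t)(k)‖² = 2 ∫_{(0,t]} Re( −4π² ⟪ẑ, T_𝔸(k) ẑ⟫ + ∑ⱼ 2πikⱼ ⟪𝓕(bⱼw) − 𝓕(b'ⱼu), ẑ⟫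
  + A ∑ⱼ 2πikⱼ ⟪𝓕(wⱼb) − 𝓕(uⱼb'), ẑ⟫ )`, `ẑ = ŵ − û` (sum of the tested identities over an
orthonormal basis of `k^⊥`, where the modes lie). [cite: RobinsonRodrigoSadowski2016, §4.2 (4.20)] -/
theorem ae_sq_norm_sub_eq (h₁ : IsWeakTensorPassiveVectorOn A T 𝔸 b w₀ w)
    (h₂ : IsWeakTensorPassiveVectorOn A T 𝔸 b' w₀ u) (hw₀ : Integrable w₀ volume) (k : d → ℤ) :
    ∀ᵐ t ∂(volume.restrict (Ioo 0 T)),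
      ‖mFourierCoeff (FunctionSpaces.EuclideanSpace.complexify ∘ w t) k -
          mFourierCoeff (FunctionSpaces.EuclideanSpace.complexify ∘ u t) k‖ ^ 2 =
        2 * ∫ τ in Ioc 0 t,
          ((-(4 * Real.pi ^ 2 : ℝ) : ℂ) *
              ⟪mFourierCoeff (FunctionSpaces.EuclideanSpace.complexify ∘ w τ) k -
                  mFourierCoeff (FunctionSpaces.EuclideanSpace.complexify ∘ u τ) k,
                symbT 𝔸 k (mFourierCoeff (FunctionSpaces.EuclideanSpace.complexify ∘ w τ) k -
                  mFourierCoeff (FunctionSpaces.EuclideanSpace.complexify ∘ u τ) k)⟫_ℂ +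
            ((∑ j, (2 * Real.pi * I * (k j)) *
                ⟪mFourierCoeff (FunctionSpaces.EuclideanSpace.complexify ∘ fun x => b τ x j • w τ x) k -
                  mFourierCoeff (FunctionSpaces.EuclideanSpace.complexify ∘ fun x => b' τ x j • u τ x) k,
                  mFourierCoeff (FunctionSpaces.EuclideanSpace.complexify ∘ w τ) k -
                    mFourierCoeff (FunctionSpaces.EuclideanSpace.complexify ∘ u τ) k⟫_ℂ) +
              (A : ℂ) * ∑ j, (2 * Real.pi * I * (k j)) *
                ⟪mFourierCoeff (FunctionSpaces.EuclideanSpace.complexify ∘ fun x => w τ x j • b τ x) k -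
                  mFourierCoeff (FunctionSpaces.EuclideanSpace.complexify ∘ fun x => u τ x j • b' τ x) k,
                  mFourierCoeff (FunctionSpaces.EuclideanSpace.complexify ∘ w τ) k -
                    mFourierCoeff (FunctionSpaces.EuclideanSpace.complexify ∘ u τ) k⟫_ℂ)).re := by
  -- names
  set X : ℝ → EuclideanSpace ℂ d := fun t => mFourierCoeff (FunctionSpaces.EuclideanSpace.complexify ∘ w t) k -
    mFourierCoeff (FunctionSpaces.EuclideanSpace.complexify ∘ u t) k with hX
  set F : d → ℝ → EuclideanSpace ℂ d := fun j τ =>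
    mFourierCoeff (FunctionSpaces.EuclideanSpace.complexify ∘ fun x => b τ x j • w τ x) k -
      mFourierCoeff (FunctionSpaces.EuclideanSpace.complexify ∘ fun x => b' τ x j • u τ x) k with hF
  set G : d → ℝ → EuclideanSpace ℂ d := fun j τ =>
    mFourierCoeff (FunctionSpaces.EuclideanSpace.complexify ∘ fun x => w τ x j • b τ x) k -
      mFourierCoeff (FunctionSpaces.EuclideanSpace.complexify ∘ fun x => u τ x j • b' τ x) k with hG
  by_cases hk : k = 0
  · -- the zero modes agree with the datum's, and the right-hand side vanishes
    subst hk
    filter_upwards [h₁.ae_mFourierCoeff_zero_eq hw₀, h₂.ae_mFourierCoeff_zero_eq hw₀] with t ht1 ht2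
    have h0 : ∫ τ in Ioc 0 t,
        ((-(4 * Real.pi ^ 2 : ℝ) : ℂ) * ⟪X τ, symbT 𝔸 0 (X τ)⟫_ℂ +
          ((∑ j, (2 * Real.pi * I * ((0 : d → ℤ) j)) * ⟪F j τ, X τ⟫_ℂ) +
            (A : ℂ) * ∑ j, (2 * Real.pi * I * ((0 : d → ℤ) j)) * ⟪G j τ, X τ⟫_ℂ)).re = 0 := by
      rw [integral_congr_ae (ae_of_all _ fun τ => ?_), integral_zero]
      simp
    rw [h0, mul_zero, ht1, ht2, sub_self, norm_zero]
    norm_num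
  -- `k ≠ 0`: sum the tested identities over an orthonormal basis of `k^⊥`
  set S : Submodule ℂ (EuclideanSpace ℂ d) :=
    (ℂ ∙ (WithLp.toLp 2 (fun j => ((k j : ℤ) : ℂ)) : EuclideanSpace ℂ d))ᗮ with hS
  let bS := stdOrthonormalBasis ℂ S
  set e : Fin (Module.finrank ℂ S) → EuclideanSpace ℂ d := fun i => (bS i : EuclideanSpace ℂ d) with he
  have he_tr : ∀ i, ∑ j, (k j : ℂ) * e i j = 0 := fun i => (mem_orthogonal_waveVec_iff k _).1 (bS i).2
  have hXt : ∀ᵐ τ ∂(volume.restrict (Ioo 0 T)), ∑ j, (k j : ℂ) * X τ j = 0 := by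
    filter_upwards [h₁.ae_sum_mul_mFourierCoeff_eq_zero k, h₂.ae_sum_mul_mFourierCoeff_eq_zero k] with τ h1 h2
    rw [hX]
    simp only [PiLp.sub_apply, mul_sub, Finset.sum_sub_distrib]
    rw [h1, h2, sub_zero]
  -- the mode right-hand side of the difference at `ζ`
  set H : EuclideanSpace ℂ d → ℝ → ℂ := fun ζ τ =>
    (-(4 * Real.pi ^ 2 : ℝ) : ℂ) * ⟪X τ, symbT 𝔸 k ζ⟫_ℂ +
      ((∑ j, (2 * Real.pi * I * (k j)) * ⟪F j τ, ζ⟫_ℂ) + (A : ℂ) * ∑ j, (2 * Real.pi * I * (k j)) * ⟪G j τ, ζ⟫_ℂ)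
    with hH
  have hHi : ∀ ζ, IntegrableOn (H ζ) (Ioo 0 T) volume := fun ζ => integrableOn_modeRHS_sub h₁ h₂ k ζ
  have hall := ae_all_iff.2 fun i => ae_sq_norm_inner_sub_eq h₁ h₂ hw₀ k (ζ := e i) (he_tr i)
  -- integrability of the summands on `(0,T)`
  obtain ⟨K, -, hK, hXi⟩ := exists_ae_norm_sub_le h₁ h₂ k
  have hIi : ∀ i, IntegrableOn (fun τ => (conj ⟪X τ, e i⟫_ℂ * H (e i) τ).re) (Ioo 0 T) volume := by
    intro i
    have hm : AEStronglyMeasurable (fun τ => conj ⟪X τ, e i⟫_ℂ) (volume.restrict (Ioo 0 T)) :=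
      Complex.continuous_conj.comp_aestronglyMeasurable (hXi.inner_const (e i)).aestronglyMeasurable
    refine (Integrable.bdd_mul (c := K * ‖e i‖) (hHi (e i)) hm ?_).re
    filter_upwards [hK] with τ hτ
    rw [Complex.norm_conj]
    exact (norm_inner_le_norm _ _).trans (mul_le_mul_of_nonneg_right hτ (norm_nonneg _))
  -- the pointwise basis identity for a transversal `X τ`
  have hframe : ∀ᵐ τ ∂(volume.restrict (Ioo 0 T)),
      ∑ i, (conj ⟪X τ, e i⟫_ℂ * H (e i) τ).re = (H (X τ) τ).re := by
    filter_upwards [hXt] with τ hτ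
    have hXS : X τ ∈ S := (mem_orthogonal_waveVec_iff k (X τ)).2 hτ
    rw [← Complex.re_sum]
    congr 1
    have hlin := modeRHS_sum_smul₇ Finset.univ 𝔸 k A (X τ) (fun j => F j τ) (fun j => G j τ)
      (fun i => conj ⟪X τ, e i⟫_ℂ) e
    rw [sum_conj_inner_smul_onb₇ bS hXS] at hlin
    rw [hH]
    exact hlin.symm
  filter_upwards [hall, hXt, ae_restrict_mem measurableSet_Ioo] with t ht hXtt htT
  have hsub : Ioc 0 t ⊆ Ioo 0 T := Ioc_subset_Ioo_right htT.2
  have hXS : X t ∈ S := (mem_orthogonal_waveVec_iff k (X t)).2 hXtt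
  have hsum : ∑ i, ‖⟪X t, e i⟫_ℂ‖ ^ 2 = ∑ i, (2 * ∫ τ in Ioc 0 t, (conj ⟪X τ, e i⟫_ℂ * H (e i) τ).re) :=
    Finset.sum_congr rfl fun i _ => ht i
  rw [sum_sq_norm_inner_onb₇ bS hXS, ← Finset.mul_sum,
    ← integral_finsetSum _ (fun i _ => (hIi i).mono_set hsub),
    integral_congr_ae (ae_restrict_of_ae_restrict_of_subset hsub hframe)] at hsum
  rw [hX] at hsum
  exact hsum


/-- Transversality of the difference modes: `∑ⱼ kⱼ (ŵ − û)(τ)(k)ⱼ = 0` for a.e. `τ` (both fields are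
weakly divergence free at a.e. time). [cite: RobinsonRodrigoSadowski2016, §4.1 (Galerkin truncations)] -/
theorem ae_sum_mul_sub_eq_zero (h₁ : IsWeakTensorPassiveVectorOn A T 𝔸 b w₀ w)
    (h₂ : IsWeakTensorPassiveVectorOn A T 𝔸 b' w₀ u) (k : d → ℤ) :
    ∀ᵐ τ ∂(volume.restrict (Ioo 0 T)), ∑ j, (k j : ℂ) *
      (mFourierCoeff (FunctionSpaces.EuclideanSpace.complexify ∘ w τ) k -
        mFourierCoeff (FunctionSpaces.EuclideanSpace.complexify ∘ u τ) k) j = 0 := by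
  filter_upwards [h₁.ae_sum_mul_mFourierCoeff_eq_zero k, h₂.ae_sum_mul_mFourierCoeff_eq_zero k] with τ h1 h2
  simp only [PiLp.sub_apply, mul_sub, Finset.sum_sub_distrib]
  rw [h1, h2, sub_zero]

/-- Integrability on `(0,T)` of the symbol term of the difference `s ↦ ⟪ẑ(s)(k), T_𝔸(k) ẑ(s)(k)⟫`.
[cite: RobinsonRodrigoSadowski2016, §4.2 (Galerkin energy estimate)] -/
theorem integrableOn_inner_symbT_sub (h₁ : IsWeakTensorPassiveVectorOn A T 𝔸 b w₀ w)
    (h₂ : IsWeakTensorPassiveVectorOn A T 𝔸 b' w₀ u) (k : d → ℤ) :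
    IntegrableOn (fun s =>
      ⟪mFourierCoeff (FunctionSpaces.EuclideanSpace.complexify ∘ w s) k -
          mFourierCoeff (FunctionSpaces.EuclideanSpace.complexify ∘ u s) k,
        symbT 𝔸 k (mFourierCoeff (FunctionSpaces.EuclideanSpace.complexify ∘ w s) k -
          mFourierCoeff (FunctionSpaces.EuclideanSpace.complexify ∘ u s) k)⟫_ℂ) (Ioo 0 T) volume := by
  obtain ⟨K, hK0, hK, hXi⟩ := exists_ae_norm_sub_le h₁ h₂ k
  obtain ⟨C, hC0, hC⟩ := exists_norm_symbT_le 𝔸 k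
  refine integrableOn_inner_of_norm_le₇ hXi
    ((continuous_symbT 𝔸 k).comp_aestronglyMeasurable hXi.aestronglyMeasurable) (K := C * K) ?_
  filter_upwards [hK] with s hs
  exact (hC _).trans (mul_le_mul_of_nonneg_left hs hC0)

/-- Integrability on `(0,T)` of the transport term of the difference against its own mode,
`s ↦ B^{w−u}_k(ẑ(s)(k))(s)`. [cite: RobinsonRodrigoSadowski2016, §4.2 (Galerkin energy estimate)] -/
theorem integrableOn_fluxRHS_sub (h₁ : IsWeakTensorPassiveVectorOn A T 𝔸 b w₀ w)
    (h₂ : IsWeakTensorPassiveVectorOn A T 𝔸 b' w₀ u) (k : d → ℤ) :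
    IntegrableOn (fun s =>
      (∑ j, (2 * Real.pi * I * (k j)) *
          ⟪mFourierCoeff (FunctionSpaces.EuclideanSpace.complexify ∘ fun x => b s x j • w s x) k -
            mFourierCoeff (FunctionSpaces.EuclideanSpace.complexify ∘ fun x => b' s x j • u s x) k,
            mFourierCoeff (FunctionSpaces.EuclideanSpace.complexify ∘ w s) k -
              mFourierCoeff (FunctionSpaces.EuclideanSpace.complexify ∘ u s) k⟫_ℂ) +
        (A : ℂ) * ∑ j, (2 * Real.pi * I * (k j)) *
          ⟪mFourierCoeff (FunctionSpaces.EuclideanSpace.complexify ∘ fun x => w s x j • b s x) k -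
            mFourierCoeff (FunctionSpaces.EuclideanSpace.complexify ∘ fun x => u s x j • b' s x) k,
            mFourierCoeff (FunctionSpaces.EuclideanSpace.complexify ∘ w s) k -
              mFourierCoeff (FunctionSpaces.EuclideanSpace.complexify ∘ u s) k⟫_ℂ) (Ioo 0 T) volume := by
  obtain ⟨K, hK0, hK, hXi⟩ := exists_ae_norm_sub_le h₁ h₂ k
  have hXm := hXi.aestronglyMeasurable
  have hF : ∀ j, IntegrableOn (fun s =>
      ⟪mFourierCoeff (FunctionSpaces.EuclideanSpace.complexify ∘ fun x => b s x j • w s x) k -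
          mFourierCoeff (FunctionSpaces.EuclideanSpace.complexify ∘ fun x => b' s x j • u s x) k,
        mFourierCoeff (FunctionSpaces.EuclideanSpace.complexify ∘ w s) k -
          mFourierCoeff (FunctionSpaces.EuclideanSpace.complexify ∘ u s) k⟫_ℂ) (Ioo 0 T) volume := fun j =>
    integrableOn_inner_of_norm_le₇
      ((h₁.integrableOn_mFourierCoeff_carrier_smul j k).sub (h₂.integrableOn_mFourierCoeff_carrier_smul j k)) hXm hK
  have hG : ∀ j, IntegrableOn (fun s =>
      ⟪mFourierCoeff (FunctionSpaces.EuclideanSpace.complexify ∘ fun x => w s x j • b s x) k -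
          mFourierCoeff (FunctionSpaces.EuclideanSpace.complexify ∘ fun x => u s x j • b' s x) k,
        mFourierCoeff (FunctionSpaces.EuclideanSpace.complexify ∘ w s) k -
          mFourierCoeff (FunctionSpaces.EuclideanSpace.complexify ∘ u s) k⟫_ℂ) (Ioo 0 T) volume := fun j =>
    integrableOn_inner_of_norm_le₇
      ((h₁.integrableOn_mFourierCoeff_smul_carrier j k).sub (h₂.integrableOn_mFourierCoeff_smul_carrier j k)) hXm hK
  have h1 : IntegrableOn (fun s => ∑ j, (2 * Real.pi * I * (k j)) *
      ⟪mFourierCoeff (FunctionSpaces.EuclideanSpace.complexify ∘ fun x => b s x j • w s x) k -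
          mFourierCoeff (FunctionSpaces.EuclideanSpace.complexify ∘ fun x => b' s x j • u s x) k,
        mFourierCoeff (FunctionSpaces.EuclideanSpace.complexify ∘ w s) k -
          mFourierCoeff (FunctionSpaces.EuclideanSpace.complexify ∘ u s) k⟫_ℂ) (Ioo 0 T) volume :=
    integrable_finsetSum _ fun j _ => (hF j).const_mul _
  have h2 : IntegrableOn (fun s => (A : ℂ) * ∑ j, (2 * Real.pi * I * (k j)) *
      ⟪mFourierCoeff (FunctionSpaces.EuclideanSpace.complexify ∘ fun x => w s x j • b s x) k -
          mFourierCoeff (FunctionSpaces.EuclideanSpace.complexify ∘ fun x => u s x j • b' s x) k,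
        mFourierCoeff (FunctionSpaces.EuclideanSpace.complexify ∘ w s) k -
          mFourierCoeff (FunctionSpaces.EuclideanSpace.complexify ∘ u s) k⟫_ℂ) (Ioo 0 T) volume :=
    (integrable_finsetSum _ fun j _ => (hG j).const_mul _).const_mul _
  exact h1.add h2

/-- Integrability on `(0,T)` of the truncated dissipation sum of the difference,
`s ↦ 4π² ∑_{|k|≤N} |k|² ‖ẑ(s)(k)‖²`. [cite: RobinsonRodrigoSadowski2016, §4.2 (Galerkin energy estimate)] -/
theorem integrableOn_gradSum_sub (h₁ : IsWeakTensorPassiveVectorOn A T 𝔸 b w₀ w)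
    (h₂ : IsWeakTensorPassiveVectorOn A T 𝔸 b' w₀ u) (N : ℕ) :
    IntegrableOn (fun s => 4 * Real.pi ^ 2 * ∑ k ∈ FunctionSpaces.Torus.freqBall N,
      FunctionSpaces.Torus.freqNormSq k *
        ‖mFourierCoeff (FunctionSpaces.EuclideanSpace.complexify ∘ w s) k -
          mFourierCoeff (FunctionSpaces.EuclideanSpace.complexify ∘ u s) k‖ ^ 2) (Ioo 0 T) volume := by
  refine (integrable_finsetSum _ fun k _ => ?_).const_mul _
  obtain ⟨K, hK0, hK, hXi⟩ := exists_ae_norm_sub_le h₁ h₂ k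
  have hm : AEStronglyMeasurable (fun s => ‖mFourierCoeff (FunctionSpaces.EuclideanSpace.complexify ∘ w s) k -
      mFourierCoeff (FunctionSpaces.EuclideanSpace.complexify ∘ u s) k‖ ^ 2) (volume.restrict (Ioo 0 T)) :=
    hXi.aestronglyMeasurable.norm.pow 2
  refine (IntegrableOn.of_bound measure_Ioo_lt_top hm (K ^ 2) ?_).const_mul _
  filter_upwards [hK] with s hs
  rw [Real.norm_eq_abs, abs_of_nonneg (sq_nonneg _)]
  exact pow_le_pow_left₀ (norm_nonneg _) hs 2

/-- **The Galerkin-truncated energy identity of the difference, Fourier form**: for a.e.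
`t ∈ (0,T)` and every `N`,
`∑_{|k|≤N} ‖ẑ(t)(k)‖² + 2 ∫_{(0,t]} 4π² ∑_{|k|≤N} Re ⟪ẑ(s)(k), T_𝔸(k) ẑ(s)(k)⟫ ds
   = 2 ∫_{(0,t]} ∑_{|k|≤N} Re B^{w−u}_k(ẑ(s)(k))(s) ds`, `ẑ = ŵ − û`
(sum of the mode energy identities of the difference over the ball; no datum term).
[cite: RobinsonRodrigoSadowski2016, §4.2 (4.20)] -/
theorem ae_sum_sq_norm_sub_eq (h₁ : IsWeakTensorPassiveVectorOn A T 𝔸 b w₀ w)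
    (h₂ : IsWeakTensorPassiveVectorOn A T 𝔸 b' w₀ u) (hw₀ : Integrable w₀ volume) :
    ∀ᵐ t ∂(volume.restrict (Ioo 0 T)), ∀ N : ℕ,
      (∑ k ∈ FunctionSpaces.Torus.freqBall N,
          ‖mFourierCoeff (FunctionSpaces.EuclideanSpace.complexify ∘ w t) k -
            mFourierCoeff (FunctionSpaces.EuclideanSpace.complexify ∘ u t) k‖ ^ 2) +
        2 * ∫ s in Ioc 0 t, 4 * Real.pi ^ 2 * ∑ k ∈ FunctionSpaces.Torus.freqBall N,
          (⟪mFourierCoeff (FunctionSpaces.EuclideanSpace.complexify ∘ w s) k -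
              mFourierCoeff (FunctionSpaces.EuclideanSpace.complexify ∘ u s) k,
            symbT 𝔸 k (mFourierCoeff (FunctionSpaces.EuclideanSpace.complexify ∘ w s) k -
              mFourierCoeff (FunctionSpaces.EuclideanSpace.complexify ∘ u s) k)⟫_ℂ).re =
      2 * ∫ s in Ioc 0 t, ∑ k ∈ FunctionSpaces.Torus.freqBall N,
        ((∑ j, (2 * Real.pi * I * (k j)) *
            ⟪mFourierCoeff (FunctionSpaces.EuclideanSpace.complexify ∘ fun x => b s x j • w s x) k -
              mFourierCoeff (FunctionSpaces.EuclideanSpace.complexify ∘ fun x => b' s x j • u s x) k,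
              mFourierCoeff (FunctionSpaces.EuclideanSpace.complexify ∘ w s) k -
                mFourierCoeff (FunctionSpaces.EuclideanSpace.complexify ∘ u s) k⟫_ℂ) +
          (A : ℂ) * ∑ j, (2 * Real.pi * I * (k j)) *
            ⟪mFourierCoeff (FunctionSpaces.EuclideanSpace.complexify ∘ fun x => w s x j • b s x) k -
              mFourierCoeff (FunctionSpaces.EuclideanSpace.complexify ∘ fun x => u s x j • b' s x) k,
              mFourierCoeff (FunctionSpaces.EuclideanSpace.complexify ∘ w s) k -
                mFourierCoeff (FunctionSpaces.EuclideanSpace.complexify ∘ u s) k⟫_ℂ).re := by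
  -- names
  set X : (d → ℤ) → ℝ → EuclideanSpace ℂ d := fun k t =>
    mFourierCoeff (FunctionSpaces.EuclideanSpace.complexify ∘ w t) k -
      mFourierCoeff (FunctionSpaces.EuclideanSpace.complexify ∘ u t) k with hX
  set Bf : (d → ℤ) → ℝ → ℂ := fun k s =>
    (∑ j, (2 * Real.pi * I * (k j)) *
        ⟪mFourierCoeff (FunctionSpaces.EuclideanSpace.complexify ∘ fun x => b s x j • w s x) k -
          mFourierCoeff (FunctionSpaces.EuclideanSpace.complexify ∘ fun x => b' s x j • u s x) k, X k s⟫_ℂ) +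
      (A : ℂ) * ∑ j, (2 * Real.pi * I * (k j)) *
        ⟪mFourierCoeff (FunctionSpaces.EuclideanSpace.complexify ∘ fun x => w s x j • b s x) k -
          mFourierCoeff (FunctionSpaces.EuclideanSpace.complexify ∘ fun x => u s x j • b' s x) k, X k s⟫_ℂ with hBf
  set Vf : (d → ℤ) → ℝ → ℂ := fun k s => ⟪X k s, symbT 𝔸 k (X k s)⟫_ℂ with hVf
  have hBi : ∀ k, IntegrableOn (fun s => (Bf k s).re) (Ioo 0 T) volume := fun k => (integrableOn_fluxRHS_sub h₁ h₂ k).re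
  have hVi : ∀ k, IntegrableOn (fun s => (Vf k s).re) (Ioo 0 T) volume := fun k => (integrableOn_inner_symbT_sub h₁ h₂ k).re
  have hHi : ∀ k, IntegrableOn (fun s => ((-(4 * Real.pi ^ 2 : ℝ) : ℂ) * Vf k s + Bf k s).re) (Ioo 0 T) volume :=
    fun k => (((integrableOn_inner_symbT_sub h₁ h₂ k).const_mul _).add (integrableOn_fluxRHS_sub h₁ h₂ k)).re
  have hmodes := ae_all_iff.2 fun k => ae_sq_norm_sub_eq h₁ h₂ hw₀ k
  filter_upwards [hmodes, ae_restrict_mem measurableSet_Ioo] with t ht htT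
  intro N
  have hsub : Ioc 0 t ⊆ Ioo 0 T := Ioc_subset_Ioo_right htT.2
  have hsum : ∑ k ∈ FunctionSpaces.Torus.freqBall N, ‖X k t‖ ^ 2 =
      ∑ k ∈ FunctionSpaces.Torus.freqBall N, (2 * ∫ s in Ioc 0 t, ((-(4 * Real.pi ^ 2 : ℝ) : ℂ) * Vf k s + Bf k s).re) :=
    Finset.sum_congr rfl fun k _ => ht k
  rw [← Finset.mul_sum, ← integral_finsetSum _ (fun k _ => (hHi k).mono_set hsub)] at hsum
  have hsplit : ∫ s in Ioc 0 t, ∑ k ∈ FunctionSpaces.Torus.freqBall N, ((-(4 * Real.pi ^ 2 : ℝ) : ℂ) * Vf k s + Bf k s).re =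
      (∫ s in Ioc 0 t, ∑ k ∈ FunctionSpaces.Torus.freqBall N, (Bf k s).re) -
        ∫ s in Ioc 0 t, 4 * Real.pi ^ 2 * ∑ k ∈ FunctionSpaces.Torus.freqBall N, (Vf k s).re := by
    have hQi' : IntegrableOn (fun s => 4 * Real.pi ^ 2 * ∑ k ∈ FunctionSpaces.Torus.freqBall N, (Vf k s).re)
        (Ioo 0 T) volume := (integrable_finsetSum _ fun k _ => hVi k).const_mul _
    have hQi : IntegrableOn (fun s => 4 * Real.pi ^ 2 * ∑ k ∈ FunctionSpaces.Torus.freqBall N, (Vf k s).re)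
        (Ioc 0 t) volume := IntegrableOn.mono_set hQi' hsub
    have hFi' : IntegrableOn (fun s => ∑ k ∈ FunctionSpaces.Torus.freqBall N, (Bf k s).re) (Ioo 0 T) volume :=
      integrable_finsetSum _ fun k _ => hBi k
    have hFi : IntegrableOn (fun s => ∑ k ∈ FunctionSpaces.Torus.freqBall N, (Bf k s).re) (Ioc 0 t) volume :=
      IntegrableOn.mono_set hFi' hsub
    rw [← integral_sub hFi hQi]
    refine integral_congr_ae (ae_of_all _ fun s => ?_)
    dsimp only
    rw [Finset.mul_sum, ← Finset.sum_sub_distrib]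
    refine Finset.sum_congr rfl fun k _ => ?_
    rw [Complex.add_re, neg_mul, Complex.neg_re, Complex.re_ofReal_mul]
    ring
  rw [hsplit] at hsum
  rw [hX] at hsum
  simp only at hsum
  linarith

end IsWeakTensorPassiveVectorOn

end Difference

/-! ## The estimate (`A = 0`) -/

section Estimate

omit [Fintype d] [DecidableEq d] in
/-- Absorption: `S + 2 lo G ≤ 2 a √G` with `S, G, a ≥ 0`, `lo > 0` forces `S ≤ a²/(2 lo)`. [folklore] -/
private theorem le_of_absorb₇ {lo S G a : ℝ} (hlo : 0 < lo) (hG : 0 ≤ G)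
    (h : S + 2 * lo * G ≤ 2 * a * Real.sqrt G) : S ≤ a ^ 2 / (2 * lo) := by
  set r := Real.sqrt G with hr
  have hr0 : 0 ≤ r := Real.sqrt_nonneg G
  have hGr : G = r ^ 2 := (Real.sq_sqrt hG).symm
  rw [hGr] at h
  rw [le_div_iff₀ (by positivity)]
  nlinarith [sq_nonneg (a - 2 * lo * r), mul_le_mul_of_nonneg_left h (by positivity : (0 : ℝ) ≤ 2 * lo)]

omit [Fintype d] [DecidableEq d] in
/-- `√f √g` is integrable for nonnegative integrable `f`, `g` (`√f√g ≤ (f+g)/2`). [folklore] -/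
private theorem integrable_sqrt_mul_sqrt₇ {α : Type*} [MeasurableSpace α] {μ : Measure α} {f g : α → ℝ}
    (hf : Integrable f μ) (hg : Integrable g μ) (hf0 : ∀ x, 0 ≤ f x) (hg0 : ∀ x, 0 ≤ g x) :
    Integrable (fun x => Real.sqrt (f x) * Real.sqrt (g x)) μ := by
  have hm : AEStronglyMeasurable (fun x => Real.sqrt (f x) * Real.sqrt (g x)) μ :=
    (Real.continuous_sqrt.comp_aestronglyMeasurable hf.1).mul (Real.continuous_sqrt.comp_aestronglyMeasurable hg.1)
  refine Integrable.mono' ((hf.add hg).div_const 2) hm (ae_of_all _ fun x => ?_)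
  rw [Real.norm_eq_abs, abs_of_nonneg (mul_nonneg (Real.sqrt_nonneg _) (Real.sqrt_nonneg _)), Pi.add_apply]
  nlinarith [Real.sq_sqrt (hf0 x), Real.sq_sqrt (hg0 x), sq_nonneg (Real.sqrt (f x) - Real.sqrt (g x))]

namespace IsWeakTensorPassiveVectorOn

variable {T : ℝ} {𝔸 : Visc4 d} {b b' w u : ℝ → UnitAddTorus d → EuclideanSpace ℝ d}
  {w₀ : UnitAddTorus d → EuclideanSpace ℝ d}

/-- **Coercivity of the truncated symbol form of the difference**: in a window `NearIso 𝔸 lo hi`,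
for a.e. `s` and every `N`, `lo · 4π² ∑_{|k|≤N} |k|²‖ẑ(s)(k)‖² ≤ 4π² ∑_{|k|≤N} Re⟪ẑ, T_𝔸(k) ẑ⟫`.
[cite: Giaquinta1983MultipleIntegrals, Ch. III §2 eq. (2.2)] [cite: Frisch1995Turbulence, §9.6.3 eq. (9.57) p. 233] -/
theorem ae_lo_mul_gradSum_sub_le {A : ℝ} (h₁ : IsWeakTensorPassiveVectorOn A T 𝔸 b w₀ w)
    (h₂ : IsWeakTensorPassiveVectorOn A T 𝔸 b' w₀ u) {lo hi : ℝ} (h𝔸 : NearIso 𝔸 lo hi) :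
    ∀ᵐ s ∂(volume.restrict (Ioo 0 T)), ∀ N : ℕ,
      lo * (4 * Real.pi ^ 2 * ∑ k ∈ FunctionSpaces.Torus.freqBall N, FunctionSpaces.Torus.freqNormSq k *
        ‖mFourierCoeff (FunctionSpaces.EuclideanSpace.complexify ∘ w s) k -
          mFourierCoeff (FunctionSpaces.EuclideanSpace.complexify ∘ u s) k‖ ^ 2) ≤
      4 * Real.pi ^ 2 * ∑ k ∈ FunctionSpaces.Torus.freqBall N,
        (⟪mFourierCoeff (FunctionSpaces.EuclideanSpace.complexify ∘ w s) k -
            mFourierCoeff (FunctionSpaces.EuclideanSpace.complexify ∘ u s) k,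
          symbT 𝔸 k (mFourierCoeff (FunctionSpaces.EuclideanSpace.complexify ∘ w s) k -
            mFourierCoeff (FunctionSpaces.EuclideanSpace.complexify ∘ u s) k)⟫_ℂ).re := by
  have htr := ae_all_iff.2 fun k => ae_sum_mul_sub_eq_zero h₁ h₂ k
  filter_upwards [htr] with s hs
  intro N
  rw [← mul_assoc, mul_comm lo, mul_assoc, Finset.mul_sum]
  refine mul_le_mul_of_nonneg_left (Finset.sum_le_sum fun k _ => ?_) (by positivity)
  exact lo_mul_le_re_inner_symbT h𝔸 (hs k)

set_option maxHeartbeats 800000 in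
/-- **The Galerkin flux of the difference, bounded** (`A = 0`). For carriers with `‖b‖ ≤ M` and
`‖b − b'‖ ≤ δ` a.e., for a.e. `s ∈ (0,T)` and every `N`, with `z = w − u`, `P = P_N z(s)`:
`∑_{|k|≤N} Re B^{w−u}_k(ẑ(s)(k))(s) = ∫⟪z − P,(b·∇)P⟫ + ∫⟪u,((b − b')·∇)P⟫
  ≤ d M (2∫‖w − P_N w‖² + 2∫‖u − P_N u‖²)^{1/2} (‖∇P‖₂²)^{1/2} + d δ (∫‖u‖²)^{1/2} (‖∇P‖₂²)^{1/2}`,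
`‖∇P‖₂² = 4π² ∑_{|k|≤N} |k|² ‖ẑ(s)(k)‖²` (dictionary Fourier ↔ physical flux, antisymmetry
`∫⟪P,(b·∇)P⟫ = 0` of the weakly divergence-free carrier, Cauchy–Schwarz).
[cite: RobinsonRodrigoSadowski2016, §4.2 (4.20)] [cite: DiPernaLions1989, §II.1 Thm. II.1] -/
theorem ae_fluxSum_sub_le (h₁ : IsWeakTensorPassiveVectorOn 0 T 𝔸 b w₀ w)
    (h₂ : IsWeakTensorPassiveVectorOn 0 T 𝔸 b' w₀ u) {M δ : ℝ} (hM : 0 ≤ M) (hδ : 0 ≤ δ)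
    (hbM : ∀ᵐ s ∂(volume.restrict (Ioo 0 T)), ∀ᵐ x ∂volume, ‖b s x‖ ≤ M)
    (hδb : ∀ᵐ s ∂(volume.restrict (Ioo 0 T)), ∀ᵐ x ∂volume, ‖b s x - b' s x‖ ≤ δ) :
    ∀ᵐ s ∂(volume.restrict (Ioo 0 T)), ∀ N : ℕ,
      ∑ k ∈ FunctionSpaces.Torus.freqBall N,
        ((∑ j, (2 * Real.pi * I * (k j)) *
            ⟪mFourierCoeff (FunctionSpaces.EuclideanSpace.complexify ∘ fun x => b s x j • w s x) k -
              mFourierCoeff (FunctionSpaces.EuclideanSpace.complexify ∘ fun x => b' s x j • u s x) k,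
              mFourierCoeff (FunctionSpaces.EuclideanSpace.complexify ∘ w s) k -
                mFourierCoeff (FunctionSpaces.EuclideanSpace.complexify ∘ u s) k⟫_ℂ) +
          ((0 : ℝ) : ℂ) * ∑ j, (2 * Real.pi * I * (k j)) *
            ⟪mFourierCoeff (FunctionSpaces.EuclideanSpace.complexify ∘ fun x => w s x j • b s x) k -
              mFourierCoeff (FunctionSpaces.EuclideanSpace.complexify ∘ fun x => u s x j • b' s x) k,
              mFourierCoeff (FunctionSpaces.EuclideanSpace.complexify ∘ w s) k -
                mFourierCoeff (FunctionSpaces.EuclideanSpace.complexify ∘ u s) k⟫_ℂ).re ≤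
        Fintype.card d * M *
            Real.sqrt (2 * (∫ x, ‖w s x - FunctionSpaces.Torus.fourierTruncate N (w s) x‖ ^ 2) +
              2 * ∫ x, ‖u s x - FunctionSpaces.Torus.fourierTruncate N (u s) x‖ ^ 2) *
            Real.sqrt (4 * Real.pi ^ 2 * ∑ k ∈ FunctionSpaces.Torus.freqBall N, FunctionSpaces.Torus.freqNormSq k *
              ‖mFourierCoeff (FunctionSpaces.EuclideanSpace.complexify ∘ w s) k -
                mFourierCoeff (FunctionSpaces.EuclideanSpace.complexify ∘ u s) k‖ ^ 2) +
          Fintype.card d * δ * Real.sqrt (∫ x, ‖u s x‖ ^ 2) *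
            Real.sqrt (4 * Real.pi ^ 2 * ∑ k ∈ FunctionSpaces.Torus.freqBall N, FunctionSpaces.Torus.freqNormSq k *
              ‖mFourierCoeff (FunctionSpaces.EuclideanSpace.complexify ∘ w s) k -
                mFourierCoeff (FunctionSpaces.EuclideanSpace.complexify ∘ u s) k‖ ^ 2) := by
  filter_upwards [h₁.ae_integrable_slice, h₂.ae_integrable_slice, h₁.ae_memLp_two, h₂.ae_memLp_two,
    h₁.ae_isWeaklyDivFree_carrier, h₁.ae_aestronglyMeasurable_slice, hbM, hδb]
    with s hs1 hs2 hm1 hm2 hbdiv hsm1 hbs hδs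
  intro N
  -- ### the difference slice and its truncation
  set v : UnitAddTorus d → EuclideanSpace ℝ d := fun x => w s x - u s x with hv
  have hvi : Integrable v volume := hs1.1.sub hs2.1
  have hv2 : MemLp v 2 volume := hm1.sub hm2
  set c : (d → ℤ) → EuclideanSpace ℂ d := fun k =>
    mFourierCoeff (FunctionSpaces.EuclideanSpace.complexify ∘ w s) k -
      mFourierCoeff (FunctionSpaces.EuclideanSpace.complexify ∘ u s) k with hc
  have hck : ∀ k, mFourierCoeff (FunctionSpaces.EuclideanSpace.complexify ∘ v) k = c k := by
    intro k
    rw [hv, show (fun x => w s x - u s x) = w s - u s from rfl, FunctionSpaces.Torus.complexify_comp_sub,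
      FunctionSpaces.Torus.mFourierCoeff_sub (FunctionSpaces.Torus.integrable_complexify_comp hs1.1)
        (FunctionSpaces.Torus.integrable_complexify_comp hs2.1)]
  set P : UnitAddTorus d → EuclideanSpace ℝ d := FunctionSpaces.Torus.fourierTruncate N v with hP
  have hPs : FunctionSpaces.Torus.IsSmooth P := FunctionSpaces.Torus.isSmooth_fourierTruncate N v
  have hPc : P = FunctionSpaces.Torus.realTrigPoly (FunctionSpaces.Torus.freqBall N) c := by
    rw [hP, FunctionSpaces.Torus.fourierTruncate_eq]
    congr 1
    funext k
    exact hck k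
  -- ### the carriers
  have hbint : Integrable (b s) volume := Integrable.of_bound hsm1.2 M hbs
  have hbmj : ∀ j, AEStronglyMeasurable (fun x => b s x j) volume := fun j =>
    (PiLp.continuous_apply 2 (fun _ : d => ℝ) j).comp_aestronglyMeasurable hsm1.2
  have hbu : ∀ j, Integrable (fun x => b s x j • u s x) volume := by
    intro j
    have h := (hs2.1).bdd_smul M (hbmj j) (by
      filter_upwards [hbs] with x hx
      exact (PiLp.norm_apply_le (b s x) j).trans hx)
    exact h
  have hbz : ∀ j, Integrable (fun x => b s x j • v x) volume := by
    intro j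
    refine ((hs1.2.1 j).sub (hbu j)).congr (ae_of_all _ fun x => ?_)
    simp only [Pi.sub_apply, hv]
    rw [smul_sub]
  have hdbu : ∀ j, Integrable (fun x => (b s x - b' s x) j • u s x) volume := by
    intro j
    refine ((hbu j).sub (hs2.2.1 j)).congr (ae_of_all _ fun x => ?_)
    simp only [Pi.sub_apply, PiLp.sub_apply]
    rw [sub_smul]
  -- ### the Fourier flux sum in physical variables: `I₁ − I₂`
  have ha : ∀ k : d → ℤ, FunctionSpaces.Torus.IsSmooth (FunctionSpaces.Torus.realTrigPoly {k} c) :=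
    fun k => FunctionSpaces.Torus.isSmooth_realTrigPoly _ _
  have e1 : ∫ x, ⟪w s x, FunctionSpaces.Torus.convect (b s) P x⟫_ℝ =
      ∑ k ∈ FunctionSpaces.Torus.freqBall N, (∑ j, (2 * Real.pi * I * (k j)) *
        ⟪mFourierCoeff (FunctionSpaces.EuclideanSpace.complexify ∘ fun x => b s x j • w s x) k, c k⟫_ℂ).re := by
    rw [hPc, realTrigPoly_eq_sum_singleton₇ (FunctionSpaces.Torus.freqBall N) c,
      ← sum_mul_integral_inner_convect_eq (FunctionSpaces.Torus.freqBall N) (fun _ => (1 : ℝ)) ha hs1.2.1]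
    refine Finset.sum_congr rfl fun k _ => ?_
    rw [one_mul, integral_inner_convect_realTrigPoly_singleton hs1.2.1 k c]
  have e2 : ∫ x, ⟪u s x, FunctionSpaces.Torus.convect (b' s) P x⟫_ℝ =
      ∑ k ∈ FunctionSpaces.Torus.freqBall N, (∑ j, (2 * Real.pi * I * (k j)) *
        ⟪mFourierCoeff (FunctionSpaces.EuclideanSpace.complexify ∘ fun x => b' s x j • u s x) k, c k⟫_ℂ).re := by
    rw [hPc, realTrigPoly_eq_sum_singleton₇ (FunctionSpaces.Torus.freqBall N) c,
      ← sum_mul_integral_inner_convect_eq (FunctionSpaces.Torus.freqBall N) (fun _ => (1 : ℝ)) ha hs2.2.1]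
    refine Finset.sum_congr rfl fun k _ => ?_
    rw [one_mul, integral_inner_convect_realTrigPoly_singleton hs2.2.1 k c]
  have hLHS : ∑ k ∈ FunctionSpaces.Torus.freqBall N,
      ((∑ j, (2 * Real.pi * I * (k j)) *
          ⟪mFourierCoeff (FunctionSpaces.EuclideanSpace.complexify ∘ fun x => b s x j • w s x) k -
            mFourierCoeff (FunctionSpaces.EuclideanSpace.complexify ∘ fun x => b' s x j • u s x) k, c k⟫_ℂ) +
        ((0 : ℝ) : ℂ) * ∑ j, (2 * Real.pi * I * (k j)) *
          ⟪mFourierCoeff (FunctionSpaces.EuclideanSpace.complexify ∘ fun x => w s x j • b s x) k -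
            mFourierCoeff (FunctionSpaces.EuclideanSpace.complexify ∘ fun x => u s x j • b' s x) k, c k⟫_ℂ).re =
      (∫ x, ⟪w s x, FunctionSpaces.Torus.convect (b s) P x⟫_ℝ) - ∫ x, ⟪u s x, FunctionSpaces.Torus.convect (b' s) P x⟫_ℝ := by
    rw [e1, e2, ← Finset.sum_sub_distrib]
    refine Finset.sum_congr rfl fun k _ => ?_
    rw [Complex.ofReal_zero, zero_mul, add_zero, ← Complex.sub_re, ← Finset.sum_sub_distrib]
    congr 1
    refine Finset.sum_congr rfl fun j _ => ?_
    rw [inner_sub_left, mul_sub]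
  -- ### the physical split `I₁ − I₂ = I₃ + I₄`
  have i1 := integrable_inner_convect_of_integrable_smul hs1.2.1 hPs
  have i2 := integrable_inner_convect_of_integrable_smul hs2.2.1 hPs
  have i3 := integrable_inner_convect_of_integrable_smul (u := b s) (v := v) hbz hPs
  have i4 := integrable_inner_convect_of_integrable_smul (u := fun x => b s x - b' s x) (v := u s) hdbu hPs
  have hconv : ∀ x, FunctionSpaces.Torus.convect (fun y => b s y - b' s y) P x =
      FunctionSpaces.Torus.convect (b s) P x - FunctionSpaces.Torus.convect (b' s) P x := fun x => by
    simp [FunctionSpaces.Torus.convect, map_sub]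
  have hsplit : (∫ x, ⟪w s x, FunctionSpaces.Torus.convect (b s) P x⟫_ℝ) - ∫ x, ⟪u s x, FunctionSpaces.Torus.convect (b' s) P x⟫_ℝ =
      (∫ x, ⟪v x, FunctionSpaces.Torus.convect (b s) P x⟫_ℝ) +
        ∫ x, ⟪u s x, FunctionSpaces.Torus.convect (fun y => b s y - b' s y) P x⟫_ℝ := by
    rw [← integral_sub i1 i2, ← integral_add i3 i4]
    refine integral_congr_ae (ae_of_all _ fun x => ?_)
    dsimp only
    rw [hconv x, hv]
    simp only [inner_sub_left, inner_sub_right]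
    ring
  -- ### the remainder form of `I₃` and the two bounds
  have hrem : ∫ x, ⟪v x, FunctionSpaces.Torus.convect (b s) P x⟫_ℝ =
      ∫ x, ⟪v x - P x, FunctionSpaces.Torus.convect (b s) P x⟫_ℝ := by
    rw [hP]
    exact integral_inner_convect_fourierTruncate_eq_remainder hbint hbdiv hbz N
  have hvP : MemLp (fun x => v x - P x) 2 volume := hv2.sub (FunctionSpaces.Torus.memLp_fourierTruncate N v 2)
  have hR := abs_integral_inner_convect_le_of_norm_le (u := b s) hvP hM hbs hPs
  have hX := abs_integral_inner_convect_le_of_norm_le (u := fun x => b s x - b' s x) hm2 hδ hδs hPs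
  -- ### `‖∇P‖₂²` in Fourier variables
  have hgrad : FunctionSpaces.Torus.gradNormSq P = 4 * Real.pi ^ 2 * ∑ k ∈ FunctionSpaces.Torus.freqBall N,
      FunctionSpaces.Torus.freqNormSq k * ‖c k‖ ^ 2 := by
    rw [hP, gradNormSq_fourierTruncate, FunctionSpaces.Torus.fourierTruncate_eq,
      FunctionSpaces.Torus.toReal_eGradNormSq_realTrigPoly FunctionSpaces.Torus.neg_mem_freqBall_of_mem
        (FunctionSpaces.Torus.isConjSymm_mFourierCoeff hvi)]
    congr 1
    exact Finset.sum_congr rfl fun k _ => by rw [hck k]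
  -- ### the tail of the difference against the two tails
  have hPlin : ∀ x, P x = FunctionSpaces.Torus.fourierTruncate N (w s) x - FunctionSpaces.Torus.fourierTruncate N (u s) x := by
    intro x
    have hcf : c = (fun k => mFourierCoeff (FunctionSpaces.EuclideanSpace.complexify ∘ w s) k) -
        (fun k => mFourierCoeff (FunctionSpaces.EuclideanSpace.complexify ∘ u s) k) := by
      funext k; simp only [Pi.sub_apply, hc]
    rw [hPc, hcf, FunctionSpaces.Torus.realTrigPoly_sub, Pi.sub_apply, FunctionSpaces.Torus.fourierTruncate_eq,
      FunctionSpaces.Torus.fourierTruncate_eq]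
  have htail : ∫ x, ‖v x - P x‖ ^ 2 ≤
      2 * (∫ x, ‖w s x - FunctionSpaces.Torus.fourierTruncate N (w s) x‖ ^ 2) +
        2 * ∫ x, ‖u s x - FunctionSpaces.Torus.fourierTruncate N (u s) x‖ ^ 2 := by
    have j1 : Integrable (fun x => ‖w s x - FunctionSpaces.Torus.fourierTruncate N (w s) x‖ ^ 2) volume :=
      (hm1.sub (FunctionSpaces.Torus.memLp_fourierTruncate N (w s) 2)).integrable_norm_pow two_ne_zero
    have j2 : Integrable (fun x => ‖u s x - FunctionSpaces.Torus.fourierTruncate N (u s) x‖ ^ 2) volume :=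
      (hm2.sub (FunctionSpaces.Torus.memLp_fourierTruncate N (u s) 2)).integrable_norm_pow two_ne_zero
    have hpt : ∀ x, ‖v x - P x‖ ^ 2 ≤
        2 * ‖w s x - FunctionSpaces.Torus.fourierTruncate N (w s) x‖ ^ 2 +
          2 * ‖u s x - FunctionSpaces.Torus.fourierTruncate N (u s) x‖ ^ 2 := by
      intro x
      have e : v x - P x = (w s x - FunctionSpaces.Torus.fourierTruncate N (w s) x) -
          (u s x - FunctionSpaces.Torus.fourierTruncate N (u s) x) := by
        rw [hPlin x, hv]
        beta_reduce
        abel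
      rw [e]
      nlinarith [norm_sub_le (w s x - FunctionSpaces.Torus.fourierTruncate N (w s) x)
          (u s x - FunctionSpaces.Torus.fourierTruncate N (u s) x),
        norm_nonneg ((w s x - FunctionSpaces.Torus.fourierTruncate N (w s) x) -
          (u s x - FunctionSpaces.Torus.fourierTruncate N (u s) x)),
        sq_nonneg (‖w s x - FunctionSpaces.Torus.fourierTruncate N (w s) x‖ -
          ‖u s x - FunctionSpaces.Torus.fourierTruncate N (u s) x‖)]
    calc ∫ x, ‖v x - P x‖ ^ 2
        ≤ ∫ x, (2 * ‖w s x - FunctionSpaces.Torus.fourierTruncate N (w s) x‖ ^ 2 +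
            2 * ‖u s x - FunctionSpaces.Torus.fourierTruncate N (u s) x‖ ^ 2) :=
          integral_mono_of_nonneg (ae_of_all _ fun x => sq_nonneg _) ((j1.const_mul 2).add (j2.const_mul 2))
            (ae_of_all _ hpt)
      _ = 2 * (∫ x, ‖w s x - FunctionSpaces.Torus.fourierTruncate N (w s) x‖ ^ 2) +
            2 * ∫ x, ‖u s x - FunctionSpaces.Torus.fourierTruncate N (u s) x‖ ^ 2 := by
          rw [integral_add (j1.const_mul 2) (j2.const_mul 2), integral_const_mul, integral_const_mul]
  -- ### assemble
  have hg0 : 0 ≤ 4 * Real.pi ^ 2 * ∑ k ∈ FunctionSpaces.Torus.freqBall N,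
      FunctionSpaces.Torus.freqNormSq k * ‖c k‖ ^ 2 :=
    mul_nonneg (by positivity) (Finset.sum_nonneg fun k _ =>
      mul_nonneg (FunctionSpaces.Torus.freqNormSq_nonneg k) (sq_nonneg _))
  rw [hLHS, hsplit, hrem, ← hgrad]
  refine (add_le_add (le_abs_self _) (le_abs_self _)).trans (add_le_add (hR.trans ?_) hX)
  refine mul_le_mul_of_nonneg_right (mul_le_mul_of_nonneg_left (Real.sqrt_le_sqrt htail) (by positivity))
    (Real.sqrt_nonneg _)

set_option maxHeartbeats 800000 in
/-- **Energy-class stability under perturbation of the carrier** (`A = 0`, constant tensor in a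
Legendre–Hadamard window `NearIso 𝔸 lo hi`, `0 < lo`; `w` along `b` with `‖b‖ ≤ M`, `u` along `b'`,
`‖b − b'‖ ≤ δ` a.e., same integrable datum): for a.e. `t ∈ (0,T)`,
`∫ ‖w(t) − u(t)‖² ≤ (d² δ² / (2 lo)) ∫_{(0,t]} ∫ ‖u(s)‖² ds` — no Grönwall factor in `M`
(Galerkin identity of the difference, antisymmetric transport remainder `→ 0` by the Parseval
tails, the cross flux absorbed into `lo ‖∇P_N z‖²`, `N → ∞`).
[cite: RobinsonRodrigoSadowski2016, §4.2 (4.20)] [cite: DiPernaLions1989, §II.1 Thm. II.1] -/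
theorem ae_integral_norm_sq_sub_le_of_carriers (h₁ : IsWeakTensorPassiveVectorOn 0 T 𝔸 b w₀ w)
    (h₂ : IsWeakTensorPassiveVectorOn 0 T 𝔸 b' w₀ u) {lo hi : ℝ} (h𝔸 : NearIso 𝔸 lo hi) (hlo : 0 < lo)
    (hw₀ : Integrable w₀ volume) {M δ : ℝ} (hM : 0 ≤ M) (hδ : 0 ≤ δ)
    (hbM : ∀ᵐ s ∂(volume.restrict (Ioo 0 T)), ∀ᵐ x ∂volume, ‖b s x‖ ≤ M)
    (hδb : ∀ᵐ s ∂(volume.restrict (Ioo 0 T)), ∀ᵐ x ∂volume, ‖b s x - b' s x‖ ≤ δ) :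
    ∀ᵐ t ∂(volume.restrict (Ioo 0 T)),
      ∫ x, ‖w t x - u t x‖ ^ 2 ≤
        (Fintype.card d : ℝ) ^ 2 * δ ^ 2 / (2 * lo) * ∫ s in Ioc 0 t, ∫ x, ‖u s x‖ ^ 2 := by
  classical
  -- ### notation
  set X : (d → ℤ) → ℝ → EuclideanSpace ℂ d := fun k s =>
    mFourierCoeff (FunctionSpaces.EuclideanSpace.complexify ∘ w s) k -
      mFourierCoeff (FunctionSpaces.EuclideanSpace.complexify ∘ u s) k with hX
  set Q : ℕ → ℝ → ℝ := fun N s => 4 * Real.pi ^ 2 * ∑ k ∈ FunctionSpaces.Torus.freqBall N,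
    (⟪X k s, symbT 𝔸 k (X k s)⟫_ℂ).re with hQ
  set Bs : ℕ → ℝ → ℝ := fun N s => ∑ k ∈ FunctionSpaces.Torus.freqBall N,
    ((∑ j, (2 * Real.pi * I * (k j)) *
        ⟪mFourierCoeff (FunctionSpaces.EuclideanSpace.complexify ∘ fun x => b s x j • w s x) k -
          mFourierCoeff (FunctionSpaces.EuclideanSpace.complexify ∘ fun x => b' s x j • u s x) k, X k s⟫_ℂ) +
      ((0 : ℝ) : ℂ) * ∑ j, (2 * Real.pi * I * (k j)) *
        ⟪mFourierCoeff (FunctionSpaces.EuclideanSpace.complexify ∘ fun x => w s x j • b s x) k -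
          mFourierCoeff (FunctionSpaces.EuclideanSpace.complexify ∘ fun x => u s x j • b' s x) k, X k s⟫_ℂ).re with hBs
  set g : ℕ → ℝ → ℝ := fun N s => 4 * Real.pi ^ 2 * ∑ k ∈ FunctionSpaces.Torus.freqBall N,
    FunctionSpaces.Torus.freqNormSq k * ‖X k s‖ ^ 2 with hg
  set f : ℕ → ℝ → ℝ := fun N s =>
    2 * (∫ x, ‖w s x - FunctionSpaces.Torus.fourierTruncate N (w s) x‖ ^ 2) +
      2 * ∫ x, ‖u s x - FunctionSpaces.Torus.fourierTruncate N (u s) x‖ ^ 2 with hf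
  set eu : ℝ → ℝ := fun s => ∫ x, ‖u s x‖ ^ 2 with heu
  set C₁ : ℝ := Fintype.card d * M with hC₁
  set C₂ : ℝ := Fintype.card d * δ with hC₂
  have hC₁0 : 0 ≤ C₁ := by positivity
  have hC₂0 : 0 ≤ C₂ := by positivity
  have hf0 : ∀ N s, 0 ≤ f N s := fun N s =>
    add_nonneg (mul_nonneg two_pos.le (integral_nonneg fun x => sq_nonneg _))
      (mul_nonneg two_pos.le (integral_nonneg fun x => sq_nonneg _))
  have hg0 : ∀ N s, 0 ≤ g N s := fun N s => mul_nonneg (by positivity)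
    (Finset.sum_nonneg fun k _ => mul_nonneg (FunctionSpaces.Torus.freqNormSq_nonneg k) (sq_nonneg _))
  have heu0 : ∀ s, 0 ≤ eu s := fun s => integral_nonneg fun x => sq_nonneg _
  -- ### the three a.e. inputs
  have hId : ∀ᵐ t ∂(volume.restrict (Ioo 0 T)), ∀ N,
      (∑ k ∈ FunctionSpaces.Torus.freqBall N, ‖X k t‖ ^ 2) + 2 * ∫ s in Ioc 0 t, Q N s = 2 * ∫ s in Ioc 0 t, Bs N s :=
    ae_sum_sq_norm_sub_eq h₁ h₂ hw₀
  have hflux : ∀ᵐ s ∂(volume.restrict (Ioo 0 T)), ∀ N,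
      Bs N s ≤ C₁ * Real.sqrt (f N s) * Real.sqrt (g N s) + C₂ * Real.sqrt (eu s) * Real.sqrt (g N s) :=
    ae_fluxSum_sub_le h₁ h₂ hM hδ hbM hδb
  have hcoer : ∀ᵐ s ∂(volume.restrict (Ioo 0 T)), ∀ N, lo * g N s ≤ Q N s :=
    ae_lo_mul_gradSum_sub_le h₁ h₂ h𝔸
  -- ### integrability on `(0,T)`
  have hBsi : ∀ N, IntegrableOn (Bs N) (Ioo 0 T) := fun N => by
    have h := integrable_finsetSum (FunctionSpaces.Torus.freqBall N) fun k _ => (integrableOn_fluxRHS_sub h₁ h₂ k).re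
    exact h.congr (ae_of_all _ fun s => rfl)
  have hQi : ∀ N, IntegrableOn (Q N) (Ioo 0 T) := fun N =>
    (integrable_finsetSum (FunctionSpaces.Torus.freqBall N) fun k _ => (integrableOn_inner_symbT_sub h₁ h₂ k).re).const_mul _
  have hgi : ∀ N, IntegrableOn (g N) (Ioo 0 T) := fun N => integrableOn_gradSum_sub h₁ h₂ N
  obtain ⟨htwi, -, -⟩ := h₁.galerkin_tail
  obtain ⟨htui, -, -⟩ := h₂.galerkin_tail
  have hfi : ∀ N, IntegrableOn (f N) (Ioo 0 T) := fun N => ((htwi N).const_mul 2).add ((htui N).const_mul 2)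
  have heui : IntegrableOn eu (Ioo 0 T) := h₂.integrableOn_integral_norm_sq
  -- ### the tails vanish in `L¹(0,T)`
  have hft : Tendsto (fun N => ∫ s in Ioo 0 T, f N s) atTop (𝓝 0) := by
    have h1 := h₁.tendsto_integral_galerkin_tail
    have h2 := h₂.tendsto_integral_galerkin_tail
    have h := (h1.const_mul 2).add (h2.const_mul 2)
    rw [mul_zero, add_zero] at h
    refine h.congr fun N => ?_
    rw [hf]
    simp only
    rw [integral_add ((htwi N).const_mul 2) ((htui N).const_mul 2), integral_const_mul, integral_const_mul]
  -- ### conclude at a.e. `t`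
  filter_upwards [hId, h₁.ae_memLp_two, h₂.ae_memLp_two, h₁.ae_integrable_slice, h₂.ae_integrable_slice,
    ae_restrict_mem measurableSet_Ioo] with t ht hm1 hm2 hs1 hs2 htT
  have hsub : Ioc 0 t ⊆ Ioo 0 T := Ioc_subset_Ioo_right htT.2
  set E : ℝ := ∫ s in Ioc 0 t, eu s with hE
  have hE0 : 0 ≤ E := setIntegral_nonneg measurableSet_Ioc fun s _ => heu0 s
  -- the bound for every `N`
  have hSN : ∀ N, ∑ k ∈ FunctionSpaces.Torus.freqBall N, ‖X k t‖ ^ 2 ≤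
      (C₁ * Real.sqrt (∫ s in Ioo 0 T, f N s) + C₂ * Real.sqrt E) ^ 2 / (2 * lo) := by
    intro N
    set G : ℝ := ∫ s in Ioc 0 t, g N s with hG
    have hG0 : 0 ≤ G := setIntegral_nonneg measurableSet_Ioc fun s _ => hg0 N s
    -- coercivity in time
    have hQG : lo * G ≤ ∫ s in Ioc 0 t, Q N s := by
      rw [hG, ← integral_const_mul]
      exact integral_mono_ae (IntegrableOn.mono_set ((hgi N).const_mul lo) hsub) ((hQi N).mono_set hsub)
        (ae_restrict_of_ae_restrict_of_subset hsub (hcoer.mono fun s hs => hs N))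
    -- the flux in time
    have hsfg' : IntegrableOn (fun s => Real.sqrt (f N s) * Real.sqrt (g N s)) (Ioo 0 T) :=
      integrable_sqrt_mul_sqrt₇ (hfi N) (hgi N) (hf0 N) (hg0 N)
    have hsfg : IntegrableOn (fun s => Real.sqrt (f N s) * Real.sqrt (g N s)) (Ioc 0 t) := hsfg'.mono_set hsub
    have hseg' : IntegrableOn (fun s => Real.sqrt (eu s) * Real.sqrt (g N s)) (Ioo 0 T) :=
      integrable_sqrt_mul_sqrt₇ heui (hgi N) heu0 (hg0 N)
    have hseg : IntegrableOn (fun s => Real.sqrt (eu s) * Real.sqrt (g N s)) (Ioc 0 t) := hseg'.mono_set hsub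
    have hBa : ∫ s in Ioc 0 t, Bs N s ≤ (C₁ * Real.sqrt (∫ s in Ioo 0 T, f N s) + C₂ * Real.sqrt E) * Real.sqrt G := by
      calc ∫ s in Ioc 0 t, Bs N s
          ≤ ∫ s in Ioc 0 t, (C₁ * (Real.sqrt (f N s) * Real.sqrt (g N s)) + C₂ * (Real.sqrt (eu s) * Real.sqrt (g N s))) := by
            refine integral_mono_ae ((hBsi N).mono_set hsub) ((hsfg.const_mul C₁).add (hseg.const_mul C₂)) ?_
            refine ae_restrict_of_ae_restrict_of_subset hsub (hflux.mono fun s hs => ?_)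
            have h := hs N
            calc Bs N s ≤ C₁ * Real.sqrt (f N s) * Real.sqrt (g N s) + C₂ * Real.sqrt (eu s) * Real.sqrt (g N s) := h
              _ = C₁ * (Real.sqrt (f N s) * Real.sqrt (g N s)) + C₂ * (Real.sqrt (eu s) * Real.sqrt (g N s)) := by ring
        _ = C₁ * (∫ s in Ioc 0 t, Real.sqrt (f N s) * Real.sqrt (g N s)) +
              C₂ * ∫ s in Ioc 0 t, Real.sqrt (eu s) * Real.sqrt (g N s) := by
            rw [integral_add (hsfg.const_mul C₁) (hseg.const_mul C₂), integral_const_mul, integral_const_mul]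
        _ ≤ C₁ * (Real.sqrt (∫ s in Ioc 0 t, f N s) * Real.sqrt G) + C₂ * (Real.sqrt E * Real.sqrt G) := by
            refine add_le_add (mul_le_mul_of_nonneg_left ?_ hC₁0) (mul_le_mul_of_nonneg_left ?_ hC₂0)
            · exact integral_sqrt_mul_sqrt_le₇ ((hfi N).mono_set hsub) ((hgi N).mono_set hsub)
                (ae_of_all _ fun s => hf0 N s) (ae_of_all _ fun s => hg0 N s)
            · exact integral_sqrt_mul_sqrt_le₇ (heui.mono_set hsub) ((hgi N).mono_set hsub)
                (ae_of_all _ fun s => heu0 s) (ae_of_all _ fun s => hg0 N s)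
        _ ≤ C₁ * (Real.sqrt (∫ s in Ioo 0 T, f N s) * Real.sqrt G) + C₂ * (Real.sqrt E * Real.sqrt G) := by
            refine add_le_add (mul_le_mul_of_nonneg_left (mul_le_mul_of_nonneg_right (Real.sqrt_le_sqrt ?_)
              (Real.sqrt_nonneg _)) hC₁0) le_rfl
            exact setIntegral_mono_set (hfi N) (ae_of_all _ fun s => hf0 N s) hsub.eventuallyLE
        _ = (C₁ * Real.sqrt (∫ s in Ioo 0 T, f N s) + C₂ * Real.sqrt E) * Real.sqrt G := by ring
    -- absorb
    have hmain : (∑ k ∈ FunctionSpaces.Torus.freqBall N, ‖X k t‖ ^ 2) + 2 * lo * G ≤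
        2 * (C₁ * Real.sqrt (∫ s in Ioo 0 T, f N s) + C₂ * Real.sqrt E) * Real.sqrt G := by
      have h := ht N
      nlinarith [h, hQG, hBa]
    exact le_of_absorb₇ hlo hG0 hmain
  -- ### the limit `N → ∞`
  have hz2 : MemLp (fun x => w t x - u t x) 2 volume := hm1.sub hm2
  have hck : ∀ k, mFourierCoeff (FunctionSpaces.EuclideanSpace.complexify ∘ fun x => w t x - u t x) k = X k t := by
    intro k
    rw [show (fun x => w t x - u t x) = w t - u t from rfl, FunctionSpaces.Torus.complexify_comp_sub,
      FunctionSpaces.Torus.mFourierCoeff_sub (FunctionSpaces.Torus.integrable_complexify_comp hs1.1)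
        (FunctionSpaces.Torus.integrable_complexify_comp hs2.1)]
  have hS : Tendsto (fun N => ∑ k ∈ FunctionSpaces.Torus.freqBall N, ‖X k t‖ ^ 2) atTop (𝓝 (∫ x, ‖w t x - u t x‖ ^ 2)) := by
    have h := (FunctionSpaces.Torus.hasSum_sq_norm_mFourierCoeff_complexify hz2).comp FunctionSpaces.Torus.tendsto_freqBall_atTop
    refine h.congr fun N => ?_
    refine Finset.sum_congr rfl fun k _ => ?_
    dsimp only
    rw [hck k]
  have hR : Tendsto (fun N => (C₁ * Real.sqrt (∫ s in Ioo 0 T, f N s) + C₂ * Real.sqrt E) ^ 2 / (2 * lo)) atTop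
      (𝓝 ((C₁ * Real.sqrt 0 + C₂ * Real.sqrt E) ^ 2 / (2 * lo))) :=
    ((((Real.continuous_sqrt.tendsto 0).comp hft).const_mul C₁).add tendsto_const_nhds).pow 2 |>.div_const _
  have hlim := le_of_tendsto_of_tendsto' hS hR hSN
  rw [Real.sqrt_zero, mul_zero, zero_add, mul_pow, Real.sq_sqrt hE0, hC₂, mul_pow] at hlim
  calc ∫ x, ‖w t x - u t x‖ ^ 2 ≤ (Fintype.card d : ℝ) ^ 2 * δ ^ 2 * E / (2 * lo) := hlim
    _ = (Fintype.card d : ℝ) ^ 2 * δ ^ 2 / (2 * lo) * E := by ring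

/-- **Energy-class stability against the datum energy** (`A = 0`): with moreover `w₀ ∈ L²` weakly
divergence free and `b' ∈ L^∞` (so that `∫‖u(s)‖² ≤ ∫‖w₀‖²`, the energy inequality of `u`), for
a.e. `t ∈ (0,T)`,
`∫ ‖w(t) − u(t)‖² ≤ (d² δ² t / (2 lo)) ∫ ‖w₀‖²`.
This is the quantitative input of the K1L tail step: the smallness ratio is `δ²/lo`.
[cite: RobinsonRodrigoSadowski2016, §4.2 (4.20)] [cite: DiPernaLions1989, §II.1 Thm. II.1] -/
theorem ae_integral_norm_sq_sub_le_mul_datum (h₁ : IsWeakTensorPassiveVectorOn 0 T 𝔸 b w₀ w)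
    (h₂ : IsWeakTensorPassiveVectorOn 0 T 𝔸 b' w₀ u) {lo hi : ℝ} (h𝔸 : NearIso 𝔸 lo hi) (hlo : 0 < lo)
    (hw₀ : MemLp w₀ 2 volume) (hdiv₀ : FunctionSpaces.Torus.IsWeaklyDivFree w₀)
    (hb' : MemLp (FunctionSpaces.Torus.stLift b') ∞ (volume.restrict (Ioo 0 T ×ˢ univ)))
    {M δ : ℝ} (hM : 0 ≤ M) (hδ : 0 ≤ δ)
    (hbM : ∀ᵐ s ∂(volume.restrict (Ioo 0 T)), ∀ᵐ x ∂volume, ‖b s x‖ ≤ M)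
    (hδb : ∀ᵐ s ∂(volume.restrict (Ioo 0 T)), ∀ᵐ x ∂volume, ‖b s x - b' s x‖ ≤ δ) :
    ∀ᵐ t ∂(volume.restrict (Ioo 0 T)),
      ∫ x, ‖w t x - u t x‖ ^ 2 ≤
        (Fintype.card d : ℝ) ^ 2 * δ ^ 2 * t / (2 * lo) * ∫ x, ‖w₀ x‖ ^ 2 := by
  have hmain := ae_integral_norm_sq_sub_le_of_carriers h₁ h₂ h𝔸 hlo (hw₀.integrable one_le_two) hM hδ hbM hδb
  have hen : ∀ᵐ s ∂(volume.restrict (Ioo 0 T)), ∫ x, ‖u s x‖ ^ 2 ≤ ∫ x, ‖w₀ x‖ ^ 2 := by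
    filter_upwards [h₂.ae_energy_ineq h𝔸 hlo hw₀ hdiv₀ hb'] with s hs
    have h1 : ENNReal.ofReal (∫ x, ‖u s x‖ ^ 2) ≤ ENNReal.ofReal (∫ x, ‖w₀ x‖ ^ 2) := le_trans le_self_add hs
    exact (ENNReal.ofReal_le_ofReal_iff (integral_nonneg fun x => sq_nonneg _)).1 h1
  have hen' : ∀ᵐ s ∂(volume : Measure ℝ), s ∈ Ioo 0 T → ∫ x, ‖u s x‖ ^ 2 ≤ ∫ x, ‖w₀ x‖ ^ 2 :=
    (ae_restrict_iff' measurableSet_Ioo).1 hen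
  have heui : IntegrableOn (fun s => ∫ x, ‖u s x‖ ^ 2) (Ioo 0 T) := h₂.integrableOn_integral_norm_sq
  filter_upwards [hmain, ae_restrict_mem measurableSet_Ioo] with t ht htT
  have hsub : Ioc 0 t ⊆ Ioo 0 T := Ioc_subset_Ioo_right htT.2
  have hE : ∫ s in Ioc 0 t, ∫ x, ‖u s x‖ ^ 2 ≤ t * ∫ x, ‖w₀ x‖ ^ 2 := by
    have h1 : ∫ s in Ioc 0 t, ∫ x, ‖u s x‖ ^ 2 ≤ ∫ s in Ioc 0 t, ∫ x, ‖w₀ x‖ ^ 2 := by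
      refine integral_mono_ae (heui.mono_set hsub) (integrableOn_const (by
        rw [Real.volume_Ioc]; exact ENNReal.ofReal_ne_top)) ?_
      have h2 : ∀ᵐ s ∂(volume : Measure ℝ), s ∈ Ioc 0 t → ∫ x, ‖u s x‖ ^ 2 ≤ ∫ x, ‖w₀ x‖ ^ 2 := by
        filter_upwards [hen'] with s hs hsI
        exact hs (hsub hsI)
      exact (ae_restrict_iff' measurableSet_Ioc).2 h2
    rw [setIntegral_const, smul_eq_mul, measureReal_def, Real.volume_Ioc, ENNReal.toReal_ofReal (by linarith [htT.1]),
      sub_zero] at h1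
    exact h1
  calc ∫ x, ‖w t x - u t x‖ ^ 2 ≤ (Fintype.card d : ℝ) ^ 2 * δ ^ 2 / (2 * lo) * ∫ s in Ioc 0 t, ∫ x, ‖u s x‖ ^ 2 := ht
    _ ≤ (Fintype.card d : ℝ) ^ 2 * δ ^ 2 / (2 * lo) * (t * ∫ x, ‖w₀ x‖ ^ 2) :=
        mul_le_mul_of_nonneg_left hE (by positivity)
    _ = (Fintype.card d : ℝ) ^ 2 * δ ^ 2 * t / (2 * lo) * ∫ x, ‖w₀ x‖ ^ 2 := by ring


omit [Fintype d] [DecidableEq d] in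
/-- Cauchy–Schwarz for pairings of `L²` fields: `|∫ ⟪a, w⟫| ≤ √(∫ ‖a‖²) · √(∫ ‖w‖²)`. [folklore] -/
private theorem abs_integral_inner_le_sqrt_mul_sqrt₇ {α : Type*} [MeasurableSpace α] {μ : Measure α}
    {E : Type*} [NormedAddCommGroup E] [InnerProductSpace ℝ E] {a z : α → E} (ha : MemLp a 2 μ) (hz : MemLp z 2 μ) :
    |∫ x, ⟪a x, z x⟫_ℝ ∂μ| ≤ Real.sqrt (∫ x, ‖a x‖ ^ 2 ∂μ) * Real.sqrt (∫ x, ‖z x‖ ^ 2 ∂μ) := by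
  have h1 : |∫ x, ⟪a x, z x⟫_ℝ ∂μ| ≤ ∫ x, ‖a x‖ * ‖z x‖ ∂μ := by
    rw [← Real.norm_eq_abs]
    refine (norm_integral_le_integral_norm _).trans (integral_mono_of_nonneg
      (ae_of_all _ fun x => norm_nonneg _) (ha.norm.integrable_mul hz.norm)
      (ae_of_all _ fun x => norm_inner_le_norm _ _))
  have h2 := integral_mul_le_Lp_mul_Lq_of_nonneg Real.HolderConjugate.two_two
    (ae_of_all _ fun x => norm_nonneg (a x)) (ae_of_all _ fun x => norm_nonneg (z x))
    (by simpa using ha.norm) (by simpa using hz.norm)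
  refine h1.trans (h2.trans_eq ?_)
  simp only [Real.rpow_two, Real.sqrt_eq_rpow]

/-- **The drop form of the energy-class stability** (`A = 0`): for a.e. `t ∈ (0,T)`,
`∫ ‖w(t)‖² ≤ ∫ ‖u(t)‖² + (2η + η²) ∫ ‖w₀‖²`, `η² = d² δ² t / (2 lo)`
(`‖w(t)‖ ≤ ‖u(t)‖ + ‖w(t) − u(t)‖`, `‖u(t)‖ ≤ ‖w₀‖` by the energy inequality, and
`ae_integral_norm_sq_sub_le_mul_datum`). In the K1L tail step this reads
`drop w₀ u t ≤ drop w₀ w t + (2η + η²)‖w₀‖²`.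
[cite: RobinsonRodrigoSadowski2016, §4.2 (4.20)] [cite: DiPernaLions1989, §II.1 Thm. II.1] -/
theorem ae_integral_norm_sq_le_add_of_carriers (h₁ : IsWeakTensorPassiveVectorOn 0 T 𝔸 b w₀ w)
    (h₂ : IsWeakTensorPassiveVectorOn 0 T 𝔸 b' w₀ u) {lo hi : ℝ} (h𝔸 : NearIso 𝔸 lo hi) (hlo : 0 < lo)
    (hw₀ : MemLp w₀ 2 volume) (hdiv₀ : FunctionSpaces.Torus.IsWeaklyDivFree w₀)
    (hb' : MemLp (FunctionSpaces.Torus.stLift b') ∞ (volume.restrict (Ioo 0 T ×ˢ univ)))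
    {M δ : ℝ} (hM : 0 ≤ M) (hδ : 0 ≤ δ)
    (hbM : ∀ᵐ s ∂(volume.restrict (Ioo 0 T)), ∀ᵐ x ∂volume, ‖b s x‖ ≤ M)
    (hδb : ∀ᵐ s ∂(volume.restrict (Ioo 0 T)), ∀ᵐ x ∂volume, ‖b s x - b' s x‖ ≤ δ) :
    ∀ᵐ t ∂(volume.restrict (Ioo 0 T)),
      ∫ x, ‖w t x‖ ^ 2 ≤ (∫ x, ‖u t x‖ ^ 2) +
        (2 * Real.sqrt ((Fintype.card d : ℝ) ^ 2 * δ ^ 2 * t / (2 * lo)) +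
          (Fintype.card d : ℝ) ^ 2 * δ ^ 2 * t / (2 * lo)) * ∫ x, ‖w₀ x‖ ^ 2 := by
  have hmain := ae_integral_norm_sq_sub_le_mul_datum h₁ h₂ h𝔸 hlo hw₀ hdiv₀ hb' hM hδ hbM hδb
  have hen : ∀ᵐ s ∂(volume.restrict (Ioo 0 T)), ∫ x, ‖u s x‖ ^ 2 ≤ ∫ x, ‖w₀ x‖ ^ 2 := by
    filter_upwards [h₂.ae_energy_ineq h𝔸 hlo hw₀ hdiv₀ hb'] with s hs
    have h1 : ENNReal.ofReal (∫ x, ‖u s x‖ ^ 2) ≤ ENNReal.ofReal (∫ x, ‖w₀ x‖ ^ 2) := le_trans le_self_add hs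
    exact (ENNReal.ofReal_le_ofReal_iff (integral_nonneg fun x => sq_nonneg _)).1 h1
  filter_upwards [hmain, hen, h₁.ae_memLp_two, h₂.ae_memLp_two, ae_restrict_mem measurableSet_Ioo]
    with t ht hB hm1 hm2 htT
  -- names
  set E₀ : ℝ := ∫ x, ‖w₀ x‖ ^ 2 with hE₀
  set η2 : ℝ := (Fintype.card d : ℝ) ^ 2 * δ ^ 2 * t / (2 * lo) with hη2
  set B : ℝ := ∫ x, ‖u t x‖ ^ 2 with hBdef
  set Z : ℝ := ∫ x, ‖w t x - u t x‖ ^ 2 with hZ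
  have hE0 : 0 ≤ E₀ := integral_nonneg fun x => sq_nonneg _
  have hη0 : 0 ≤ η2 := by rw [hη2]; have := htT.1.le; positivity
  have hB0 : 0 ≤ B := integral_nonneg fun x => sq_nonneg _
  have hZ0 : 0 ≤ Z := integral_nonneg fun x => sq_nonneg _
  have hz2 : MemLp (fun x => w t x - u t x) 2 volume := hm1.sub hm2
  -- expand `‖u + z‖²`
  have iB := hm2.integrable_norm_pow two_ne_zero
  have iZ : Integrable (fun x => ‖w t x - u t x‖ ^ 2) volume := hz2.integrable_norm_pow two_ne_zero
  have iP : Integrable (fun x => ‖u t x‖ * ‖w t x - u t x‖) volume := hm2.norm.integrable_mul hz2.norm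
  have iI : Integrable (fun x => ⟪u t x, w t x - u t x⟫_ℝ) volume :=
    Integrable.mono' iP (hm2.1.inner hz2.1) (ae_of_all _ fun x => by
      rw [Real.norm_eq_abs]; exact abs_real_inner_le_norm (u t x) (w t x - u t x))
  have hexp : ∫ x, ‖w t x‖ ^ 2 = B + 2 * (∫ x, ⟪u t x, w t x - u t x⟫_ℝ) + Z := by
    have hpt : ∀ x, ‖w t x‖ ^ 2 = ‖u t x‖ ^ 2 + 2 * ⟪u t x, w t x - u t x⟫_ℝ + ‖w t x - u t x‖ ^ 2 := by
      intro x
      have e : w t x = u t x + (w t x - u t x) := by abel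
      conv_lhs => rw [e]
      rw [norm_add_sq_real]
    have iBI : Integrable (fun x => ‖u t x‖ ^ 2 + 2 * ⟪u t x, w t x - u t x⟫_ℝ) volume := iB.add (iI.const_mul 2)
    simp_rw [hpt]
    rw [integral_add iBI iZ, integral_add iB (iI.const_mul 2), integral_const_mul]
  -- Cauchy–Schwarz and the two bounds
  have hCS : ∫ x, ⟪u t x, w t x - u t x⟫_ℝ ≤ Real.sqrt B * Real.sqrt Z :=
    (le_abs_self _).trans (abs_integral_inner_le_sqrt_mul_sqrt₇ hm2 hz2)
  have hZle : Z ≤ η2 * E₀ := ht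
  have hsB : Real.sqrt B ≤ Real.sqrt E₀ := Real.sqrt_le_sqrt hB
  have hsZ : Real.sqrt Z ≤ Real.sqrt η2 * Real.sqrt E₀ := by
    rw [← Real.sqrt_mul hη0]
    exact Real.sqrt_le_sqrt hZle
  have hprod : Real.sqrt B * Real.sqrt Z ≤ Real.sqrt η2 * E₀ := by
    calc Real.sqrt B * Real.sqrt Z ≤ Real.sqrt E₀ * (Real.sqrt η2 * Real.sqrt E₀) :=
          mul_le_mul hsB hsZ (Real.sqrt_nonneg _) (Real.sqrt_nonneg _)
      _ = Real.sqrt η2 * (Real.sqrt E₀ * Real.sqrt E₀) := by ring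
      _ = Real.sqrt η2 * E₀ := by rw [Real.mul_self_sqrt hE0]
  rw [hexp]
  nlinarith [hCS, hprod, hZle]

end IsWeakTensorPassiveVectorOn

end Estimate

end Torus

end Literature.Analysis.FluidPDE

end
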